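import Literature.MathematicalPhysics.QuantumFieldTheory.BalabanImbrieJaffe1984to88.BIJ88DeltaLocSmallPlaquetteTorusCwt
import Literature.MathematicalPhysics.QuantumFieldTheory.BalabanImbrieJaffe1984to88.BIJ88Decay241RegularTorusCwtOrbit
import Literature.MathematicalPhysics.QuantumFieldTheory.BalabanImbrieJaffe1984to88.BIJ88NeumannPropagatorSmallPlaquetteRegion

/-!
# `BalabanImbrieJaffe1984to88.BIJ88DeltaLocSmallPlaquetteTorusCwtGauge` — T. Bałaban, J. Imbrie, A. Jaffe, *Effective action and cluster properties
of the abelian Higgs model*, Commun. Math. Phys. **114** (1988) 257–315 [BalabanImbrieJaffe1988], §2 (2.40)–(2.41) p. 264 [PDF 8] and (4.9) p. 275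
[PDF 19]; [I] = Commun. Math. Phys. **97** (1985) 299–329 [BalabanImbrieJaffe1985], §7.3 p. 326 [PDF 28]: **(2.40)/(4.9)_{j≥1} AND (2.41) FOR
`Δ_{k,loc}(u)` AND `C^{(k)}_Λ(u)` WITH `Ω = T_η` AT A GENERAL SMALL-PLAQUETTE `U(1)` FIELD, FOR THE PRINTED TORUS DATA, WITH THE AVERAGED-FIELD
SMALLNESS DISCHARGED BY THE CHANGE OF GAUGE OF [I] p. 326, AND (§4) WITH THE CONSTANTS CHOSEN BEFORE THE INSTANCE** — gen 22's `BIJ88DeltaLocSmallPlaquetteTorusCwt` §6–§7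
(`Z49_smallPlaquette_torus_cwt`, `decay241_smallPlaquette_torus_cwt`) carry the [I] (4.5.4)-type smallness `(T₁, δ′, σ)` of the averaged field
`u_k = lineIter u k` inside the `L`-blocks of `T^{(k)}` as hypotheses; it is not gauge invariant, but the conclusions are.  Here it is REMOVED:
the plaquettes of `u_k` are `≤ L^{2k}θ` (r15/p11's abelian Stokes `norm_plaqC_lineIter_sub_one_le`); p34/p27's blockwise centred gauge `g` of `u_k`
on `T^{(k)}` (`smallField_blockGauge`, blocks of side `L`) makes `(u_k)^g` `T₁`-small with `T₁ = (d′−1)(L−1)L^{2k}θ`; its lift `h = g ∘ blk_k` to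
`T^{(0)}` satisfies `(u^h)_k = (u_k)^g` ((2.8) `lineIter_gaugeAct`) and leaves the plaquettes of `u` unchanged (`plaqC_gaugeAct`); so §6–§7 apply to
`u^h` with `σ = ½` once `L^{2k}θ ≤ 1/(4d′²L²)` (gen 22's `smallness_of_sup`), and the conclusions transfer back to `u = (u^h)^{h⁻¹}` because the
precision `Δ_{k,loc}(u) + κP(u_k)` is the unitary diagonal conjugate of the one at `u^h` (gen 21's `op240_deltaLocT_gaugeAct`), which preserves
positive definiteness of the realified compression, `Z^{(k)}_Λ` and the absolute values of the entries of `C^{(k)}_Λ` (gen 22's Orbit kernels).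

statement-level skeleton of published theorems with citation tags; proofs where landed; nothing here is a claim about the Yang–Mills mass gap

PDFs held: `paper:balaban1988-cmp114-bij-abelian-higgs-effective-action` (journal page = PDF page + 256; p. 264 = PDF 8, p. 275 = PDF 19);
`paper:balaban1985-cmp97-bij-higgs-minimizers` (journal page = PDF page + 298; p. 326 = PDF 28, re-read this session).

CITATION HEADER (lean-in-tree rule).  lit-balaban cell (HOME `run/shared/lean/pub/lit-balaban/`), Phase 2, proof seat **p31 gen 22** (unit
`lit-balaban-p31`, literature-prover-lit-balaban-p31-g22-0), free-target protocol G.5-34(d), TAKING #3 line HOME/STATUS.md 2026-08-23T06:46:31Z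
(window → 07:12Z; stem check `CwtGauge` = ∅; notices to r18 g25, p34 g18 / p27 g36, r15).  Rows of `HOME/lit-balaban-r18/ROWS-C2.md` served
(LOCATED MEMBERS, cells only; heads unchanged; owner r18): **C2.Eq2.40**, **C2.Eq2.41** (+ the (4.9)_{j≥1} token of C3) «general small-plaquette
`u`, no averaged-field hypothesis»; r15's **C1.Eq7.3.1-7.3.2** (the p. 326 change-of-gauge sentence, located as a theorem: `exists_blockGauge_lineIter`).
Files USED BY NAME, nothing restated: gen 22 `BIJ88DeltaLocSmallPlaquetteTorusCwt` (`Z49_smallPlaquette_torus_cwt`, `decay241_smallPlaquette_torus_cwt`;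
p355030), gen 22 `BIJ88Decay241RegularTorusCwtOrbit` (`plaqC_gaugeAct`, `posDef_realify_compress_unitConj`, `z49Triple_of_posDef`, `smallness_of_sup`;
p354504), gen 21 `BIJ88Decay241SmallPlaquetteTorus.op240_deltaLocT_gaugeAct`, p34 g17 / p27 g34 `BIJ88NeumannPropagatorSmallPlaquetteRegion.smallField_blockGauge`
(p30's `centredGauge` inside), p34 `BIJ88BgInvariance416Torus.compress_diagonal_sandwich`, `BIJ88BlockGauge417.gaugeAct_inv_gaugeAct`, r15/p11
`BIJ85AbelianStokes` (`plaqC`, `plaqC_eq_toC_plaqHol`, `norm_plaqC_lineIter_sub_one_le`), r18 `BIJ85BlockAveragesTorusK` (`lineIter`, `holCK`,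
`blkIter`, `cornerIter`, `lineIter_gaugeAct`, `blkIter_cornerIter`), p29 `BIJ88LocWeights227Torus` (`cubeFam`, `lamFam`, `labels`, `cubeFam_fits`),
p27 `BIJ88NeumannPropagatorFlatDecayCube.isBlockUnion_cubeT`, gen 15 `BIJ88DeltaLoc234Torus` (`deltaLocT`, `mulOpK`), gen 18 `BIJ88Eq240FlatTorus`
(`realify`, `compress`, `op240`, `c240`), p03 `BIJ88Normalization46.Z49`, pv07 `B4Sect5Proof.latticeConst`, p38 `B5Ineq137Torus.T`.

## The print (verbatim, p. 264 [PDF 8]; p. 275 [PDF 19]; [I] p. 326 [PDF 28])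

p. 264: *"We define C^{(k)}_Λ(u) = [(Δ_{k,loc}(u) + aL^{−2} Q(u_k)^* Q(u_k))|_Λ]^{−1}. (2.40) This is of course a nonlocal operator, but by (2.38),
C^{(k)}_Λ(u)^{−1} is bounded below and a random walk expansion as in [6] can be used to prove that |C^{(k)}_Λ(u; x₁, x₂)| ≦ c e^{−c|x₁−x₂|}. (2.41)"*;
p. 275: *"Z^{(j)}_Λ = ∫ dφ_Λ exp[−½⟨φ, (Δ + κP(u))|_Λ φ⟩ − E|Λ|] (4.9)"* (the Gaussian normalization, `j ≥ 1`).
[I] p. 326: *"The propagators arising from Δ_k(u_k), under the restriction (7.3.1) on the gauge field, also satisfy the regularity and decay estimates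
of [7]. In order to remain within the framework of this reference, we remark that by change of gauge u_k can be transformed in a local region Λ into
a configuration of the form exp[ie_kηA], where A is smooth and small."*

## What is proved (0 `sorry`; theorems only — no definition, no `Prop`-valued fact)

* §1 kernels: `exists_blockGauge` (existence form of `smallField_blockGauge` for blocks of side `L`, any level with a next lattice),
  `lineIter_gaugeAct_lift` (`(u^{g∘blk_k})_k = (u_k)^g`), `plaqHol_lineIter_small` (`‖u_k(∂p′) − 1‖ ≤ L^{2k}θ`), private `T1_le_of_threshold`,
  **`exists_blockGauge_lineIter`** — THE CHANGE OF GAUGE OF [I] p. 326 FOR THE AVERAGED FIELD: if `‖u(∂p) − 1‖ ≤ θ` on `T^{(0)}`,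
  `L^{2k}θ ≤ 1/(4d′²L²)` and `2(L−1) + 4 < |T^{(k)}|`, there is `h : T^{(0)} → U(1)` with `‖(u^h)_k(b) − 1‖ ≤ T₁` inside the `L`-blocks of `T^{(k)}`,
  `‖(u^h)_k(Γ_{yx}) − 1‖ ≤ d′(L−1)T₁`, `T₁ = (d′−1)(L−1)L^{2k}θ`, and `2(L−1)L·d′·T₁² + 2(d′(L−1)T₁)² ≤ ½`; and **`op240_deltaLocT_inv_gaugeAct`**:
  `Δ_{k,loc}(u) + κP(u_k) = M^{(k)}_{h⁻¹}·(Δ_{k,loc}(u^h) + κP((u^h)_k))·M^{(k)ᴴ}_{h⁻¹}` for cube families of `k`-block unions.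
* §2 **`Z49_smallPlaquette_torus_cwt_gauge`** — (2.40) + (4.9)_{j≥1}: the data and constants `δ₀, c₀` of gen 22's `Z49_smallPlaquette_torus_cwt`
  (`2 ≤ d′ ≤ 3`, `L = ℓ + 1` odd, level `1 ≤ k ≤ K` with `k + 1 ≤ m + K`, `2(L^k − 1) + 4 < |T^{(0)}|`, `‖u(∂p) − 1‖ ≤ θ`, `(L^{2k}θ)² ≤ 1/500`, reference
  box, spacing, half-width, radii `R > 10L^k`, `0 ≤ R₁ < R₀`, deep `Λ`) WITHOUT the `(T₁, δ′, σ)` hypotheses, replaced by `L^{2k}θ ≤ 1/(4d′²L²)` and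
  `2(L−1) + 4 < |T^{(k)}|`; for every `κ′ ≥ 0` with `E < c240(γ₀, κ′)·(1 − ½)` and all `E_s, N`: `realify((Δ_{k,loc}(u) + (A/a_k)κ′P(u_k))|_Λ)` is
  positive definite, `Z^{(k)}_Λ = e^{−E_sN}(2π)^{#(Λ×2)/2}/√det`, `Z^{(k)}_Λ > 0` — AT `u` ITSELF, no gauge condition.
* §3 **`decay241_smallPlaquette_torus_cwt_gauge`** — (2.41): under the same data, `0 ≤ ϑ ≤ δ₀/4` and the walk-expansion smallness with `σ = ½`:
  `‖C^{(k)}_Λ(u; x₁, x₂)‖ ≤ (a_k/A)·(4/(c240(γ₀,κ′)/2 − E))·e^{−ϑ|x₁−x₂|_{T^{(k)}}}` for all `x₁, x₂ ∈ Λ`, at `u` itself.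
* §4 **`decay241_smallPlaquette_torus_cwt_uniform`**, **`Z49_smallPlaquette_torus_cwt_uniform`** — THE SAME WITH THE CONSTANTS CHOSEN BEFORE THE
  INSTANCE (print's form): for `2 ≤ d′ ≤ 3`, `L ≥ 3` odd, `a > 0`, `κ̂ > 0`, `M_max`: `∃ θ₀ ρ₀ δ₁ c₂ > 0` (resp. `∃ θ₀ ρ₀ > 0`) depending on
  `(d, L, a, κ̂, M_max)` only, such that for EVERY torus, level `1 ≤ k ≤ K` (`k + 1 ≤ m + K`, no-wrap conditions), EVERY `U(1)` field with
  `‖u(∂p) − 1‖ ≤ θ`, `(L^{2k}θ)² ≤ θ₀`, every reference box / spacing / half-width, radii `R ≥ (10 + ρ₀)L^k`, `ρ₀L^k ≤ R₁ < R₀`, multiplicity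
  `≤ M_max`, deep `Λ`: **`‖C^{(k)}_Λ(u; x₁, x₂)‖ ≤ (a_k/A)·c₂·e^{−δ₁|x₁−x₂|_{T^{(k)}}}`**, and the (2.40)/(4.9) triple — NO hypothesis on `u` beyond
  the plaquette smallness (gen 21's `BIJ88Decay241RegularTorusCwtUniform` threshold arithmetic, verbatim).
* §5 (v1.1, append-only) **`decay241_smallPlaquette_torus_cwt_uniform_nonvacuous`** — the hypotheses of §4's (2.41) member, thresholds included,
  are JOINTLY SATISFIABLE: for every `(a, κ̂)` an explicit torus / level / flat background / box / spacing / radii / `Λ = {y₁}` chosen AFTER the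
  constants `θ₀ ρ₀ δ₁ c₂` (with `M_max = 9`) meets every displayed hypothesis, and the bound holds there.

HONEST SCOPE / DIVERGENCE.  (i)–(vi), (viii)–(ix) of gen 22's `BIJ88DeltaLocSmallPlaquetteTorusCwt` verbatim (`Ω = T_η`; global (7.3.1)-type
smallness with explicit thresholds; `2 ≤ d′ ≤ 3`, `L` odd `≥ 3`, `k ≤ K`; p29's torus cubes, `X_α` = `10L^k`-deep rows, `R > 10L^k`; `δ₀, c₀`
existential from `(d, ℓ, a)`; (2.38) two-constant reading; value members; `k + 1 ≤ m + K`).  (vii′) The averaged-field smallness is now a THEOREM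
(`exists_blockGauge_lineIter`) under the additional plaquette threshold `L^{2k}θ ≤ 1/(4d′²L²)` (so that `σ = ½`; print: `θ = e_kp(e_k) → 0`) and the
no-wrap condition `2(L−1) + 4 < |T^{(k)}|` of p30's centred axial gauge on `T^{(k)}`; the numeric CONDITIONS `hE` (with `σ = ½`) and `hsmall` of
(2.40)/(2.41) stay displayed exactly as in the `_gen` members in §2–§3 and are DISCHARGED in §4 by thresholds `θ₀, ρ₀` and a multiplicity cap
`M_max` chosen before the instance (print's *"by (2.38), C^{(k)}_Λ(u)^{−1} is bounded below"*: at the printed radii `R, R₁ ~ r(e_k)L^k → ∞·L^k` and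
`θ = e_kp(e_k) → 0` the thresholds are met; print's multiplicity is `O(1)` = at most `2^d` terms, here `M_max` is a parameter).  (x) The change of
gauge is GLOBAL on the torus (blockwise centred axial gauges glued as a product over `L`-blocks of `T^{(k)}`, lifted to `T^{(0)}` constant on
`k`-blocks) — print: *"in a local region Λ"*; no claim about the representative being `exp[ie_kηA]` with `A` regular (that is the Orbit file's
lineage).  Imports: gen 22 `BIJ88DeltaLocSmallPlaquetteTorusCwt` + `BIJ88Decay241RegularTorusCwtOrbit`, p34/p27 `BIJ88NeumannPropagatorSmallPlaquetteRegion`.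
Literature + Mathlib only.  Unit `lit-balaban-p31` (literature-prover-lit-balaban-p31-g22-0), 2026-08-23.  NOT summit progress.
-/

open scoped BigOperators Matrix ComplexConjugate
open Finset Matrix

namespace Literature.MathematicalPhysics.QuantumFieldTheory.BalabanImbrieJaffe1984to88.BIJ88DeltaLocSmallPlaquetteTorusCwtGauge

open Literature.MathematicalPhysics.QuantumFieldTheory.Balaban1983to89
open BIJ88Sect3Statements (U1 toC starB norm_toC)
open BIJ85BlockAveragesTorus BIJ85BlockAveragesTorusK
open BIJ88NeumannPropagator227Torus (gBox)
open BIJ88DeltaLoc234Torus (gLocT deltaLocT deltaRegion mulOpK)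
open BIJ88NeumannPropagatorFlatDecayCube (cubeT boxCoord isBlockUnion_cubeT)
open BIJ88Cutoffs21 (cutoff)
open BIJ88LocWeights227Torus
open BIJ85AbelianStokes (plaqC plaqC_eq_toC_plaqHol norm_plaqC_lineIter_sub_one_le)
open BIJ88NeumannNoZeroModesTorus (IsBlockUnion)
open BIJ88Eq240FlatTorus (realify compress op240 c240)
open BIJ88Normalization46 (Z49)
open B4Sect5Proof (latticeConst latticeConst_nonneg)
open GaugeField (gaugeAct)
open BIJ88BgInvariance416Torus (compress_diagonal_sandwich)
open BIJ88Decay241SmallPlaquetteTorus (op240_deltaLocT_gaugeAct)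
open BIJ88Decay241RegularTorusCwtOrbit (plaqC_gaugeAct posDef_realify_compress_unitConj z49Triple_of_posDef smallness_of_sup)
open BIJ88NeumannPropagatorSmallPlaquetteRegion (smallField_blockGauge)
open BIJ88BlockGauge417 (gaugeAct_inv_gaugeAct)
open BIJ88DeltaLocSmallPlaquetteTorusCwt (Z49_smallPlaquette_torus_cwt decay241_smallPlaquette_torus_cwt)

noncomputable section

variable {P : Params}

/-! ## §1 Kernels: the change of gauge of [I] p. 326 for the averaged field, and the precision along the inverse gauge transformation -/

section Kernels

variable {j : ℕ}

/-- kernel: a unitary diagonal conjugation preserves the absolute values of the entries of the inverse. [folklore] -/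
private theorem norm_inv_unitConj_apply {S : Type*} [Fintype S] [DecidableEq S] (m : S → ℂ) (hm : ∀ i, ‖m i‖ = 1)
    (Y : Matrix S S ℂ) (i l : S) : ‖(diagonal m * Y * (diagonal m)ᴴ)⁻¹ i l‖ = ‖Y⁻¹ i l‖ := by
  have hmm : ∀ i, m i * (starRingEnd ℂ) (m i) = 1 := fun i => by
    rw [Complex.mul_conj, Complex.normSq_eq_norm_sq, hm, one_pow, Complex.ofReal_one]
  have h1 : (diagonal m)ᴴ * diagonal m = 1 := by
    rw [diagonal_conjTranspose, diagonal_mul_diagonal, ← diagonal_one]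
    exact congrArg diagonal (funext fun i => by rw [Pi.star_apply, Complex.star_def, mul_comm, hmm])
  have h2 : diagonal m * (diagonal m)ᴴ = 1 := mul_eq_one_comm.1 h1
  rw [Matrix.mul_inv_rev, Matrix.mul_inv_rev, Matrix.inv_eq_left_inv h1, Matrix.inv_eq_left_inv h2, ← Matrix.mul_assoc,
    diagonal_conjTranspose, mul_diagonal, diagonal_mul, norm_mul, norm_mul, Pi.star_apply, Complex.star_def, Complex.norm_conj, hm, hm,
    one_mul, mul_one]

/-- **[I] p. 326 «by change of gauge …» for the `L`-blocks, existence form** of p34/p27's blockwise centred gauge `smallField_blockGauge` (block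
size `L`, any level `j` with a next lattice): if `‖v(∂p) − 1‖ ≤ θ′` at every plaquette of `T^{(j)}` and `2(L − 1) + 4 < |T^{(j)}|`, then for every
`T ≥ (d′−1)(L−1)θ′` there is a gauge transformation `g` with `‖v^g(b) − 1‖ ≤ T` on every bond inside an `L`-block and `‖v^g(Γ_{yx}) − 1‖ ≤ d′(L−1)T`
for every composite transport. [cite: BalabanImbrieJaffe1985, p.326 «by change of gauge»] -/
theorem exists_blockGauge (hj : j + 1 ≤ P.m + P.K) (V : GaugeField P j U1) {θ' : ℝ} (hθ' : 0 ≤ θ')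
    (hplaq : ∀ p : Balaban1983to89.Plaq P j, ‖toC (GaugeField.plaqHol V p) - 1‖ ≤ θ') (hR : 2 * (P.L - 1) + 4 < P.sitesPerDir j)
    {T : ℝ} (hT : ((P.d - 1 : ℕ) : ℝ) * ((P.L : ℝ) - 1) * θ' ≤ T) :
    ∃ g : GaugeTransf P j U1, (∀ b : PBond P j, blkIter 1 b.src = blkIter 1 b.tgt → ‖toC (gaugeAct g V b) - 1‖ ≤ T) ∧
      ∀ y : Balaban1983to89.Site P j, ‖holCK (gaugeAct g V) 1 y - 1‖ ≤ P.d * ((P.L : ℝ) - 1) * T := by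
  have hR' : 2 * (P.L ^ 1 - 1) + 4 < P.sitesPerDir j := by rwa [pow_one]
  have hT' : ((P.d - 1 : ℕ) : ℝ) * ((P.L : ℝ) ^ 1 - 1) * θ' ≤ T := by rwa [pow_one]
  have hBG := smallField_blockGauge (k := 1) hj V hθ' hplaq hR' hT'
  simp only [pow_one] at hBG
  exact ⟨_, hBG.1, hBG.2⟩

/-- kernel: **lifting a gauge transformation of `T^{(k)}` to `T^{(0)}`, constant on `k`-blocks, commutes with the `k`-fold average** —
`(u^{g∘blk})_k = (u_k)^g` ((2.8) `lineIter_gaugeAct`, `blkIter_cornerIter`). [cite: BalabanImbrieJaffe1985, (2.8) p.303] -/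
theorem lineIter_gaugeAct_lift {k : ℕ} (hk : 0 + k ≤ P.m + P.K) (g : GaugeTransf P (0 + k) U1) (U : GaugeField P 0 U1) :
    lineIter (gaugeAct (fun z => g (blkIter k z)) U) k = gaugeAct g (lineIter U k) := by
  rw [lineIter_gaugeAct _ U k hk]
  congr 1
  funext y
  exact congrArg g (blkIter_cornerIter k hk y)

/-- kernel: **the plaquettes of the averaged field** — `‖u_k(∂p′) − 1‖ ≤ L^{2k}θ` on `T^{(k)}` if `‖u(∂p) − 1‖ ≤ θ` on `T^{(0)}` (r15/p11's abelian
Stokes `norm_plaqC_lineIter_sub_one_le`). [cite: BalabanImbrieJaffe1985, (7.3.1) p.326] -/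
theorem plaqHol_lineIter_small {k : ℕ} (hk : 0 + k ≤ P.m + P.K) (U : GaugeField P 0 U1) {θ : ℝ}
    (hθ : ∀ (y : Balaban1983to89.Site P 0) (μ ν : Fin P.d), ‖plaqC U y μ ν - 1‖ ≤ θ) :
    ∀ p : Balaban1983to89.Plaq P (0 + k), ‖toC (GaugeField.plaqHol (lineIter U k) p) - 1‖ ≤ ((P.L : ℝ) ^ k) ^ 2 * θ := by
  have e2 : ((P.L : ℝ) ^ 2) ^ k = ((P.L : ℝ) ^ k) ^ 2 := by rw [← pow_mul, ← pow_mul, mul_comm]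
  rintro ⟨y, μ, ν, hμν⟩
  rw [← plaqC_eq_toC_plaqHol (lineIter U k) y hμν, ← e2]
  exact norm_plaqC_lineIter_sub_one_le U hθ k hk y μ ν

/-- kernel: the `σ = ½` threshold — `τ ≤ 1/(4d′²L²) ⟹ (d′−1)(L−1)τ ≤ 1/(4d′L)`. [folklore] -/
private theorem T1_le_of_threshold {dr Lr τ : ℝ} (hd : 1 ≤ dr) (hL : 2 ≤ Lr) (hτ0 : 0 ≤ τ) (hτ : τ ≤ 1 / (4 * dr ^ 2 * Lr ^ 2)) :
    (dr - 1) * (Lr - 1) * τ ≤ 1 / (4 * dr * Lr) := by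
  have hd0 : 0 < dr := by linarith
  have hL0 : 0 < Lr := by linarith
  have h1 : (dr - 1) * (Lr - 1) ≤ dr * Lr := by nlinarith
  calc (dr - 1) * (Lr - 1) * τ ≤ dr * Lr * (1 / (4 * dr ^ 2 * Lr ^ 2)) := mul_le_mul h1 hτ hτ0 (by positivity)
    _ = 1 / (4 * dr * Lr) := by rw [mul_one_div, div_eq_div_iff (by positivity) (by positivity)]; ring

/-- **THE CHANGE OF GAUGE OF [I] p. 326 FOR THE AVERAGED FIELD**: if `‖u(∂p) − 1‖ ≤ θ` on `T^{(0)}`, `L^{2k}θ ≤ 1/(4d′²L²)` and the `L`-block balls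
of `T^{(k)}` do not wrap, there is a gauge transformation `h` of `T^{(0)}` (the lift of the blockwise centred gauge of `u_k`) such that
`(u^h)_k` is `T₁`-small inside the `L`-blocks of `T^{(k)}`, its composite transports are within `d′(L−1)T₁` of `1`, `T₁ = (d′−1)(L−1)L^{2k}θ`, and
the [I] (4.5.4)-type condition holds with `σ = ½`. [cite: BalabanImbrieJaffe1985, p.326 «by change of gauge»] -/
theorem exists_blockGauge_lineIter {k : ℕ} (hk : 0 + k ≤ P.m + P.K) (hj : 0 + k + 1 ≤ P.m + P.K) (hL : 2 ≤ P.L) (U : GaugeField P 0 U1)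
    {θ : ℝ} (hθ0 : 0 ≤ θ) (hθ : ∀ (y : Balaban1983to89.Site P 0) (μ ν : Fin P.d), ‖plaqC U y μ ν - 1‖ ≤ θ)
    (hτ : ((P.L : ℝ) ^ k) ^ 2 * θ ≤ 1 / (4 * (P.d : ℝ) ^ 2 * (P.L : ℝ) ^ 2)) (hR : 2 * (P.L - 1) + 4 < P.sitesPerDir (0 + k)) :
    ∃ h : GaugeTransf P 0 U1,
      (∀ b : PBond P (0 + k), blkIter 1 b.src = blkIter 1 b.tgt →
          ‖toC (lineIter (gaugeAct h U) k b) - 1‖ ≤ ((P.d - 1 : ℕ) : ℝ) * ((P.L : ℝ) - 1) * (((P.L : ℝ) ^ k) ^ 2 * θ)) ∧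
      (∀ y : Balaban1983to89.Site P (0 + k), ‖holCK (lineIter (gaugeAct h U) k) 1 y - 1‖ ≤
          P.d * ((P.L : ℝ) - 1) * (((P.d - 1 : ℕ) : ℝ) * ((P.L : ℝ) - 1) * (((P.L : ℝ) ^ k) ^ 2 * θ))) ∧
      2 * (((P.L : ℝ) - 1) * P.L) * P.d * (((P.d - 1 : ℕ) : ℝ) * ((P.L : ℝ) - 1) * (((P.L : ℝ) ^ k) ^ 2 * θ)) ^ 2 +
          2 * (P.d * ((P.L : ℝ) - 1) * (((P.d - 1 : ℕ) : ℝ) * ((P.L : ℝ) - 1) * (((P.L : ℝ) ^ k) ^ 2 * θ))) ^ 2 ≤ 1 / 2 := by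
  have hτ0 : 0 ≤ ((P.L : ℝ) ^ k) ^ 2 * θ := by positivity
  obtain ⟨g, h1, h2⟩ := exists_blockGauge hj (lineIter U k) hτ0 (plaqHol_lineIter_small hk U hθ) hR
    (T := ((P.d - 1 : ℕ) : ℝ) * ((P.L : ℝ) - 1) * (((P.L : ℝ) ^ k) ^ 2 * θ)) le_rfl
  refine ⟨fun z => g (blkIter k z), fun b hb => ?_, fun y => ?_, ?_⟩
  · rw [lineIter_gaugeAct_lift hk g U]; exact h1 b hb
  · rw [lineIter_gaugeAct_lift hk g U]; exact h2 y
  · have hd1 : (1 : ℝ) ≤ P.d := by exact_mod_cast P.hd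
    have hL2 : (2 : ℝ) ≤ P.L := by exact_mod_cast hL
    have ecast : ((P.d - 1 : ℕ) : ℝ) = (P.d : ℝ) - 1 := by rw [Nat.cast_sub P.hd, Nat.cast_one]
    have hT1 : ((P.d - 1 : ℕ) : ℝ) * ((P.L : ℝ) - 1) * (((P.L : ℝ) ^ k) ^ 2 * θ) ≤ 1 / (4 * (P.d : ℝ) * P.L) := by
      rw [ecast]; exact T1_le_of_threshold hd1 hL2 hτ0 hτ
    have hT0 : 0 ≤ ((P.d - 1 : ℕ) : ℝ) * ((P.L : ℝ) - 1) * (((P.L : ℝ) ^ k) ^ 2 * θ) :=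
      mul_nonneg (mul_nonneg (Nat.cast_nonneg _) (by linarith)) hτ0
    exact smallness_of_sup hd1 hL2 hT0 hT1

/-- **THE PRECISION AT `u` IS THE UNITARY DIAGONAL CONJUGATE, BY THE INVERSE GAUGE TRANSFORMATION, OF THE PRECISION AT `u^h`**:
`Δ_{k,loc}(u) + κP(u_k) = M^{(k)}_{h⁻¹}(Δ_{k,loc}(u^h) + κP((u^h)_k))M^{(k)ᴴ}_{h⁻¹}` (gen 21's `op240_deltaLocT_gaugeAct` at `u^h` with `h⁻¹`,
`(u^h)^{h⁻¹} = u`). [cite: BalabanImbrieJaffe1988, (2.40) p.264] [cite: BalabanImbrieJaffe1985, (6.3.2) p.320] -/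
theorem op240_deltaLocT_inv_gaugeAct {k : ℕ} (hk : 0 + k ≤ P.m + P.K) (hk1 : 0 + k + 1 ≤ P.m + P.K) {a c : ℝ} (hc : c ≠ 0) (ha : 0 < a)
    (κ : ℝ) (h : GaugeTransf P 0 U1) (U : GaugeField P 0 U1) {ι : Type*} [Fintype ι] {cube : ι → Finset (Balaban1983to89.Site P 0)}
    (hcube : ∀ α, IsBlockUnion k (cube α)) (lam : ι → Balaban1983to89.Site P 0 → Balaban1983to89.Site P 0 → ℝ)
    (ζ'' : Balaban1983to89.Site P 0 → Balaban1983to89.Site P 0 → ℝ) :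
    op240 (deltaLocT a c U k cube lam ζ'') κ (lineIter U k) =
      mulOpK (fun x => (h x)⁻¹) k * op240 (deltaLocT a c (gaugeAct h U) k cube lam ζ'') κ (lineIter (gaugeAct h U) k) *
        (mulOpK (fun x => (h x)⁻¹) k)ᴴ := by
  have e1 : gaugeAct (fun x => (h x)⁻¹) (gaugeAct h U) = U := gaugeAct_inv_gaugeAct h U
  conv_lhs => rw [← e1]
  rw [lineIter_gaugeAct _ (gaugeAct h U) k hk, op240_deltaLocT_gaugeAct hk hk1 hc ha κ _ (gaugeAct h U) hcube lam ζ'']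

end Kernels

/-! ## §2 (2.40) and (4.9)_{j≥1} at a general small-plaquette field, no averaged-field hypothesis -/

section Member240

variable {d : ℕ}

/-- **(2.40) AND (4.9)_{j≥1} FOR `Δ_{k,loc}(u)`, `Ω = T_η`, AT A GENERAL SMALL-PLAQUETTE `U(1)` FIELD `u` ITSELF, FOR THE PRINTED TORUS DATA — THE
AVERAGED-FIELD SMALLNESS DISCHARGED BY THE CHANGE OF GAUGE OF [I] p. 326** (p. 264: *"We define C^{(k)}_Λ(u) = […]^{−1}. (2.40) … by (2.38),
C^{(k)}_Λ(u)^{−1} is bounded below"*; p. 275 (4.9); [I] p. 326 *«by change of gauge u_k can be transformed … A is smooth and small»*).  The data and the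
constants `δ₀, c₀` of gen 22's `Z49_smallPlaquette_torus_cwt` (`2 ≤ d′ = d+1 ≤ 3`, `L = ℓ+1` odd, `1 ≤ k ≤ K`, `k + 1 ≤ m + K`, `2(L^k−1)+4 < |T^{(0)}|`,
`‖u(∂p) − 1‖ ≤ θ`, `0 ≤ θ`, `(L^{2k}θ)² ≤ 1/500`, reference no-wrap box, `s_g ≥ 1`, `W`, radii `R > 10L^k`, `0 ≤ R₁ < R₀`, torus gap, `Λ` of `k`-sites
whose blocks lie in the box at chart depth `≥ R₀ + R`), then — INSTEAD of the `(T₁, δ′, σ)` hypotheses on `u_k` — `L^{2k}θ ≤ 1/(4d′²L²)` and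
`2(L−1) + 4 < |T^{(k)}|`; for every `κ′ ≥ 0` with `E := (4/3)d′⁴(L^{2k}θ)² + a_k²c₀e^{δ₀/2}K_{d′}(δ₀/2)(m·e^{−2δ₀R/L^k} + e^{−(δ₀/2)R₁/L^k}) <
c240(γ₀,κ′)·(1 − ½)` and all `E_s, N`: **`realify((Δ_{k,loc}(u) + (A/a_k)κ′P(u_k))|_Λ)` IS POSITIVE DEFINITE, `Z^{(k)}_Λ = e^{−E_sN}(2π)^{#(Λ×2)/2}/√det(…)`
AND `Z^{(k)}_Λ > 0`**. [cite: BalabanImbrieJaffe1988, (2.40) p.264] [cite: BalabanImbrieJaffe1988, (4.9) p.275]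
[cite: BalabanImbrieJaffe1985, p.326 «by change of gauge»] -/
theorem Z49_smallPlaquette_torus_cwt_gauge (d ℓ : ℕ) (hd1 : 1 ≤ d) (hd3 : d + 1 ≤ 3) (hℓ : 1 ≤ ℓ) (hodd : Odd (ℓ + 1)) {a : ℝ} (ha : 0 < a) :
    ∃ δ₀ c₀ : ℝ, 0 < δ₀ ∧ 0 < c₀ ∧ ∀ (P : Params) (hPd : P.d = d + 1), P.L = ℓ + 1 →
      ∀ (k : ℕ), 1 ≤ k → k ≤ P.K → k + 1 ≤ P.m + P.K → 2 * (P.L ^ k - 1) + 4 < P.sitesPerDir 0 →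
      ∀ (U : GaugeField P 0 U1) (θ : ℝ), 0 ≤ θ → (∀ (y : Balaban1983to89.Site P 0) (μ ν : Fin P.d), ‖plaqC U y μ ν - 1‖ ≤ θ) →
        (((P.L : ℝ) ^ k) ^ 2 * θ) ^ 2 ≤ 1 / 500 →
      ∀ (c M0 : Fin (d + 1) → ℕ), (∀ i, 1 ≤ M0 i) → (∀ i, c i * P.L ^ k + P.L ^ k * M0 i ≤ P.sitesPerDir 0) →
        (∀ i, P.L ^ k * M0 i < P.sitesPerDir 0) →
      ∀ (sg W : ℕ), 1 ≤ sg → ∀ (R R₀ R₁ : ℝ), 10 * (P.L : ℝ) ^ k < R → 0 ≤ R₁ → R₁ < R₀ →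
        2 * (sg : ℝ) / 3 + R₀ / 2 + R ≤ W → (∀ i, ((P.L ^ k * M0 i : ℕ) : ℝ) + R ≤ P.sitesPerDir 0) →
      ∀ (Λ : Finset (Balaban1983to89.Site P (0 + k))),
        (∀ y₁ ∈ Λ, ∀ μ, (c (Fin.cast hPd μ) : ℝ) * P.L ^ k + (R₀ + R) ≤ (P.L : ℝ) ^ k * (y₁ μ).val ∧
          (P.L : ℝ) ^ k * (y₁ μ).val + P.L ^ k + (R₀ + R) ≤ (c (Fin.cast hPd μ) : ℝ) * P.L ^ k + (P.L : ℝ) ^ k * M0 (Fin.cast hPd μ)) →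
      ((P.L : ℝ) ^ k) ^ 2 * θ ≤ 1 / (4 * (P.d : ℝ) ^ 2 * (P.L : ℝ) ^ 2) → 2 * (P.L - 1) + 4 < P.sitesPerDir (0 + k) →
      ∀ (κ' : ℝ), 0 ≤ κ' →
        4 / 3 * (P.d : ℝ) ^ 4 * (((P.L : ℝ) ^ k) ^ 2 * θ) ^ 2 +
            B1.aSeq a P.L k ^ 2 * (c₀ * Real.exp (δ₀ / 2) * latticeConst P.d (δ₀ / 2)) *
              (((⌊(((P.L : ℝ) ^ k) - 1 + R₀) / sg⌋₊ : ℝ) + 3) ^ (d + 1) *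
                  Real.exp (-(δ₀ * (((P.L : ℝ) ^ k)⁻¹ * (2 * R)))) +
                Real.exp (-(δ₀ / 2 * (((P.L : ℝ) ^ k)⁻¹ * R₁)))) <
          c240 P (min (a / (9 * (P.d + 1))) (1 / 12)) κ' * (1 - 1 / 2) →
      ∀ (Es N : ℝ),
        (realify (compress Λ (op240 (deltaLocT (B1RG242Torus.α P a k * (P.L : ℝ) ^ (k * P.d)) P.eps⁻¹ U k (cubeFam hPd (P.L ^ k) c M0 sg W)
            (lamFam hPd (P.L ^ k) c M0 sg) (cutoff R₁ R₀ (B5Ineq137Torus.T P 0)))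
            ((B1RG242Torus.α P a k * (P.L : ℝ) ^ (k * P.d)) / B1.aSeq a P.L k * κ') (lineIter U k)))).PosDef ∧
        Z49 (realify (compress Λ (op240 (deltaLocT (B1RG242Torus.α P a k * (P.L : ℝ) ^ (k * P.d)) P.eps⁻¹ U k (cubeFam hPd (P.L ^ k) c M0 sg W)
            (lamFam hPd (P.L ^ k) c M0 sg) (cutoff R₁ R₀ (B5Ineq137Torus.T P 0)))
            ((B1RG242Torus.α P a k * (P.L : ℝ) ^ (k * P.d)) / B1.aSeq a P.L k * κ') (lineIter U k)))) Es N =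
          Real.exp (-(Es * N)) * (Real.sqrt (2 * Real.pi) ^ Fintype.card (↥Λ × Fin 2) /
            Real.sqrt (realify (compress Λ (op240 (deltaLocT (B1RG242Torus.α P a k * (P.L : ℝ) ^ (k * P.d)) P.eps⁻¹ U k (cubeFam hPd (P.L ^ k) c M0 sg W)
            (lamFam hPd (P.L ^ k) c M0 sg) (cutoff R₁ R₀ (B5Ineq137Torus.T P 0)))
            ((B1RG242Torus.α P a k * (P.L : ℝ) ^ (k * P.d)) / B1.aSeq a P.L k * κ') (lineIter U k)))).det) ∧
        0 < Z49 (realify (compress Λ (op240 (deltaLocT (B1RG242Torus.α P a k * (P.L : ℝ) ^ (k * P.d)) P.eps⁻¹ U k (cubeFam hPd (P.L ^ k) c M0 sg W)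
            (lamFam hPd (P.L ^ k) c M0 sg) (cutoff R₁ R₀ (B5Ineq137Torus.T P 0)))
            ((B1RG242Torus.α P a k * (P.L : ℝ) ^ (k * P.d)) / B1.aSeq a P.L k * κ') (lineIter U k)))) Es N := by
  obtain ⟨δ₀, c₀, hδ₀, hc₀, M⟩ := Z49_smallPlaquette_torus_cwt d ℓ hd1 hd3 hℓ hodd ha
  refine ⟨δ₀, c₀, hδ₀, hc₀, ?_⟩
  intro P hPd hPL k hk1 hkK hk' hbig U θ hθ0 hθ hτ c M0 hM0 hfit0 hN0 sg W hsg R R₀ R₁ hRm hR₁ hR10 hW hgap Λ hΛ hτ2 hRk κ' hκ' hE Es N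
  have hkm : k ≤ P.m + P.K := hkK.trans (Nat.le_add_left _ _)
  have hk0 : 0 + k ≤ P.m + P.K := by omega
  have hj : 0 + k + 1 ≤ P.m + P.K := by omega
  have hL2 : 2 ≤ P.L := by rw [hPL]; omega
  obtain ⟨h, hInt, hTree, hσ⟩ := exists_blockGauge_lineIter hk0 hj hL2 U hθ0 hθ hτ2 hRk
  have hθ' : ∀ (y : Balaban1983to89.Site P 0) (μ ν : Fin P.d), ‖plaqC (gaugeAct h U) y μ ν - 1‖ ≤ θ := fun y μ ν => by
    rw [plaqC_gaugeAct]; exact hθ y μ ν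
  have hak0 : 0 < B1.aSeq a P.L k := B1.aSeq_pos ha (B1RG242Torus.one_lt_cast_L P) hk1
  have hα : 0 < B1RG242Torus.α P a k := mul_pos hak0 (inv_pos.mpr (pow_pos (P.spacing_pos k) 2))
  have hA0 : 0 < B1RG242Torus.α P a k * (P.L : ℝ) ^ (k * P.d) := mul_pos hα (pow_pos P.cast_L_pos _)
  have hcube : ∀ α : ↥(labels (P.L ^ k) M0 sg), IsBlockUnion k (cubeFam hPd (P.L ^ k) c M0 sg W α) := fun α => by
    obtain ⟨c', M', hM', hfit', -, e⟩ := cubeFam_fits (hPd := hPd) (s := sg) (W := W) hM0 hfit0 hN0 α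
    rw [e]; exact isBlockUnion_cubeT hPd hkm rfl hfit'
  have em : mulOpK (fun x => (h x)⁻¹) k = diagonal (fun y : Balaban1983to89.Site P (0 + k) => toC ((h (cornerIter k y))⁻¹)) := rfl
  have hM := M P hPd hPL k hk1 hkK hk' hbig (gaugeAct h U) θ hθ0 hθ' hτ c M0 hM0 hfit0 hN0 sg W hsg R R₀ R₁ hRm hR₁ hR10 hW hgap
    Λ hΛ _ _ (1 / 2) hInt hTree hσ κ' hκ' hE Es N
  rw [op240_deltaLocT_inv_gaugeAct hk0 hj (inv_ne_zero P.eps_pos.ne') hA0 _ h U hcube _ _, em]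
  exact z49Triple_of_posDef (posDef_realify_compress_unitConj Λ (fun y => (h (cornerIter k y))⁻¹) _ hM.1) Es N

end Member240

/-! ## §3 (2.41) at a general small-plaquette field, no averaged-field hypothesis -/

section Member241

variable {d : ℕ}

/-- **(2.41) FOR `C^{(k)}_Λ(u) = [(Δ_{k,loc}(u) + (A/a_k)κ′P(u_k))|_Λ]^{−1}`, `Ω = T_η`, AT A GENERAL SMALL-PLAQUETTE `U(1)` FIELD `u` ITSELF, FOR THE
PRINTED TORUS DATA — THE AVERAGED-FIELD SMALLNESS DISCHARGED BY THE CHANGE OF GAUGE OF [I] p. 326** (p. 264: *"a random walk expansion as in [6]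
can be used to prove that |C^{(k)}_Λ(u; x₁, x₂)| ≦ ce^{−c|x₁−x₂|}. (2.41)"*).  The data of `Z49_smallPlaquette_torus_cwt_gauge` (plaquette thresholds,
no-wrap of the `L`-blocks of `T^{(k)}`, `κ′ ≥ 0`, `E < c240(γ₀,κ′)(1 − ½)`) and a decay rate `0 ≤ ϑ ≤ δ₀/4` with
`ϑ·(4/δ₀)(2K_{d′}(δ₀/2))·(a_k(1 + m·a_kc₀e^{δ₀}) + κ′L^{−2d′}e^{δ₀(L−1)}) ≤ (c240(γ₀,κ′)(1 − ½) − E)/2`: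
**`‖C^{(k)}_Λ(u; x₁, x₂)‖ ≤ (A/a_k)^{−1}·(4/(c240(γ₀,κ′)(1 − ½) − E))·e^{−ϑ|x₁−x₂|_{T^{(k)}}}`** for all `x₁, x₂ ∈ Λ` — gen 22's
`decay241_smallPlaquette_torus_cwt` at `u^h` (`exists_blockGauge_lineIter`) and the invariance of `|C^{(k)}_Λ(x₁,x₂)|` under the unitary diagonal
conjugation `op240_deltaLocT_inv_gaugeAct`. [cite: BalabanImbrieJaffe1988, (2.41) p.264] [cite: BalabanImbrieJaffe1985, p.326 «by change of gauge»] -/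
theorem decay241_smallPlaquette_torus_cwt_gauge (d ℓ : ℕ) (hd1 : 1 ≤ d) (hd3 : d + 1 ≤ 3) (hℓ : 1 ≤ ℓ) (hodd : Odd (ℓ + 1)) {a : ℝ}
    (ha : 0 < a) :
    ∃ δ₀ c₀ : ℝ, 0 < δ₀ ∧ 0 < c₀ ∧ ∀ (P : Params) (hPd : P.d = d + 1), P.L = ℓ + 1 →
      ∀ (k : ℕ), 1 ≤ k → k ≤ P.K → k + 1 ≤ P.m + P.K → 2 * (P.L ^ k - 1) + 4 < P.sitesPerDir 0 →
      ∀ (U : GaugeField P 0 U1) (θ : ℝ), 0 ≤ θ → (∀ (y : Balaban1983to89.Site P 0) (μ ν : Fin P.d), ‖plaqC U y μ ν - 1‖ ≤ θ) →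
        (((P.L : ℝ) ^ k) ^ 2 * θ) ^ 2 ≤ 1 / 500 →
      ∀ (c M0 : Fin (d + 1) → ℕ), (∀ i, 1 ≤ M0 i) → (∀ i, c i * P.L ^ k + P.L ^ k * M0 i ≤ P.sitesPerDir 0) →
        (∀ i, P.L ^ k * M0 i < P.sitesPerDir 0) →
      ∀ (sg W : ℕ), 1 ≤ sg → ∀ (R R₀ R₁ : ℝ), 10 * (P.L : ℝ) ^ k < R → 0 ≤ R₁ → R₁ < R₀ →
        2 * (sg : ℝ) / 3 + R₀ / 2 + R ≤ W → (∀ i, ((P.L ^ k * M0 i : ℕ) : ℝ) + R ≤ P.sitesPerDir 0) →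
      ∀ (Λ : Finset (Balaban1983to89.Site P (0 + k))),
        (∀ y₁ ∈ Λ, ∀ μ, (c (Fin.cast hPd μ) : ℝ) * P.L ^ k + (R₀ + R) ≤ (P.L : ℝ) ^ k * (y₁ μ).val ∧
          (P.L : ℝ) ^ k * (y₁ μ).val + P.L ^ k + (R₀ + R) ≤ (c (Fin.cast hPd μ) : ℝ) * P.L ^ k + (P.L : ℝ) ^ k * M0 (Fin.cast hPd μ)) →
      ((P.L : ℝ) ^ k) ^ 2 * θ ≤ 1 / (4 * (P.d : ℝ) ^ 2 * (P.L : ℝ) ^ 2) → 2 * (P.L - 1) + 4 < P.sitesPerDir (0 + k) →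
      ∀ (κ' : ℝ), 0 ≤ κ' →
        4 / 3 * (P.d : ℝ) ^ 4 * (((P.L : ℝ) ^ k) ^ 2 * θ) ^ 2 +
            B1.aSeq a P.L k ^ 2 * (c₀ * Real.exp (δ₀ / 2) * latticeConst P.d (δ₀ / 2)) *
              (((⌊(((P.L : ℝ) ^ k) - 1 + R₀) / sg⌋₊ : ℝ) + 3) ^ (d + 1) *
                  Real.exp (-(δ₀ * (((P.L : ℝ) ^ k)⁻¹ * (2 * R)))) +
                Real.exp (-(δ₀ / 2 * (((P.L : ℝ) ^ k)⁻¹ * R₁)))) <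
          c240 P (min (a / (9 * (P.d + 1))) (1 / 12)) κ' * (1 - 1 / 2) →
      ∀ (ϑ : ℝ), 0 ≤ ϑ → ϑ ≤ δ₀ / 4 →
        ϑ * ((4 / δ₀) * (2 * latticeConst P.d (δ₀ / 2)) *
            (B1.aSeq a P.L k * (1 + ((⌊(((P.L : ℝ) ^ k) - 1 + R₀) / sg⌋₊ : ℝ) + 3) ^ (d + 1) * B1.aSeq a P.L k *
                (c₀ * Real.exp δ₀)) +
              κ' * (((P.L : ℝ) ^ P.d)⁻¹) ^ 2 * Real.exp (δ₀ * ((P.L : ℝ) - 1)))) ≤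
          (c240 P (min (a / (9 * (P.d + 1))) (1 / 12)) κ' * (1 - 1 / 2) -
            (4 / 3 * (P.d : ℝ) ^ 4 * (((P.L : ℝ) ^ k) ^ 2 * θ) ^ 2 +
            B1.aSeq a P.L k ^ 2 * (c₀ * Real.exp (δ₀ / 2) * latticeConst P.d (δ₀ / 2)) *
              (((⌊(((P.L : ℝ) ^ k) - 1 + R₀) / sg⌋₊ : ℝ) + 3) ^ (d + 1) *
                  Real.exp (-(δ₀ * (((P.L : ℝ) ^ k)⁻¹ * (2 * R)))) +
                Real.exp (-(δ₀ / 2 * (((P.L : ℝ) ^ k)⁻¹ * R₁)))))) / 2 →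
      ∀ (x₁ x₂ : ↥Λ),
        ‖(compress Λ (op240 (deltaLocT (B1RG242Torus.α P a k * (P.L : ℝ) ^ (k * P.d)) P.eps⁻¹ U k (cubeFam hPd (P.L ^ k) c M0 sg W)
            (lamFam hPd (P.L ^ k) c M0 sg) (cutoff R₁ R₀ (B5Ineq137Torus.T P 0)))
            ((B1RG242Torus.α P a k * (P.L : ℝ) ^ (k * P.d)) / B1.aSeq a P.L k * κ') (lineIter U k)))⁻¹ x₁ x₂‖ ≤
          ((B1RG242Torus.α P a k * (P.L : ℝ) ^ (k * P.d)) / B1.aSeq a P.L k)⁻¹ *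
            (4 / (c240 P (min (a / (9 * (P.d + 1))) (1 / 12)) κ' * (1 - 1 / 2) -
              (4 / 3 * (P.d : ℝ) ^ 4 * (((P.L : ℝ) ^ k) ^ 2 * θ) ^ 2 +
            B1.aSeq a P.L k ^ 2 * (c₀ * Real.exp (δ₀ / 2) * latticeConst P.d (δ₀ / 2)) *
              (((⌊(((P.L : ℝ) ^ k) - 1 + R₀) / sg⌋₊ : ℝ) + 3) ^ (d + 1) *
                  Real.exp (-(δ₀ * (((P.L : ℝ) ^ k)⁻¹ * (2 * R)))) +
                Real.exp (-(δ₀ / 2 * (((P.L : ℝ) ^ k)⁻¹ * R₁))))))) *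
            Real.exp (-(ϑ * B5Ineq137Torus.T P (0 + k) x₁ x₂)) := by
  obtain ⟨δ₀, c₀, hδ₀, hc₀, M⟩ := decay241_smallPlaquette_torus_cwt d ℓ hd1 hd3 hℓ hodd ha
  refine ⟨δ₀, c₀, hδ₀, hc₀, ?_⟩
  intro P hPd hPL k hk1 hkK hk' hbig U θ hθ0 hθ hτ c M0 hM0 hfit0 hN0 sg W hsg R R₀ R₁ hRm hR₁ hR10 hW hgap Λ hΛ hτ2 hRk κ' hκ' hE ϑ hϑ0 hϑ hsmall x₁ x₂
  have hkm : k ≤ P.m + P.K := hkK.trans (Nat.le_add_left _ _)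
  have hk0 : 0 + k ≤ P.m + P.K := by omega
  have hj : 0 + k + 1 ≤ P.m + P.K := by omega
  have hL2 : 2 ≤ P.L := by rw [hPL]; omega
  obtain ⟨h, hInt, hTree, hσ⟩ := exists_blockGauge_lineIter hk0 hj hL2 U hθ0 hθ hτ2 hRk
  have hθ' : ∀ (y : Balaban1983to89.Site P 0) (μ ν : Fin P.d), ‖plaqC (gaugeAct h U) y μ ν - 1‖ ≤ θ := fun y μ ν => by
    rw [plaqC_gaugeAct]; exact hθ y μ ν
  have hak0 : 0 < B1.aSeq a P.L k := B1.aSeq_pos ha (B1RG242Torus.one_lt_cast_L P) hk1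
  have hα : 0 < B1RG242Torus.α P a k := mul_pos hak0 (inv_pos.mpr (pow_pos (P.spacing_pos k) 2))
  have hA0 : 0 < B1RG242Torus.α P a k * (P.L : ℝ) ^ (k * P.d) := mul_pos hα (pow_pos P.cast_L_pos _)
  have hcube : ∀ α : ↥(labels (P.L ^ k) M0 sg), IsBlockUnion k (cubeFam hPd (P.L ^ k) c M0 sg W α) := fun α => by
    obtain ⟨c', M', hM', hfit', -, e⟩ := cubeFam_fits (hPd := hPd) (s := sg) (W := W) hM0 hfit0 hN0 α
    rw [e]; exact isBlockUnion_cubeT hPd hkm rfl hfit'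
  have em : mulOpK (fun x => (h x)⁻¹) k = diagonal (fun y : Balaban1983to89.Site P (0 + k) => toC ((h (cornerIter k y))⁻¹)) := rfl
  have hM := M P hPd hPL k hk1 hkK hk' hbig (gaugeAct h U) θ hθ0 hθ' hτ c M0 hM0 hfit0 hN0 sg W hsg R R₀ R₁ hRm hR₁ hR10 hW hgap
    Λ hΛ _ _ (1 / 2) hInt hTree hσ κ' hκ' hE ϑ hϑ0 hϑ hsmall x₁ x₂
  rw [op240_deltaLocT_inv_gaugeAct hk0 hj (inv_ne_zero P.eps_pos.ne') hA0 _ h U hcube _ _, em, compress_diagonal_sandwich,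
    norm_inv_unitConj_apply _ (fun i => norm_toC _)]
  exact hM

end Member241

/-! ## §4 (2.41) and (2.40)/(4.9) with the constants chosen before the instance -/

section Uniform

variable {d : ℕ}

/-- kernel: `e^{−x} ≤ η` once `x ≥ 1/η`, `η > 0` (`x + 1 ≤ e^x`). [folklore] -/
private theorem exp_neg_le_of_inv_le {x η : ℝ} (hη : 0 < η) (hx : 1 / η ≤ x) : Real.exp (-x) ≤ η := by
  have hx0 : 0 < x := lt_of_lt_of_le (by positivity) hx
  have h1 : x + 1 ≤ Real.exp x := Real.add_one_le_exp x
  rw [Real.exp_neg]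
  have h2 : (Real.exp x)⁻¹ ≤ (x + 1)⁻¹ := inv_anti₀ (by positivity) h1
  refine h2.trans ?_
  rw [inv_le_comm₀ (by positivity) hη]
  have : η⁻¹ = 1 / η := (one_div η).symm
  linarith

/-- **(2.41) FOR `C^{(k)}_Λ(u)` AT A GENERAL SMALL-PLAQUETTE `U(1)` FIELD, `Ω = T_η`, PRINTED TORUS DATA — NO GAUGE CONDITION, CONSTANTS CHOSEN BEFORE
THE INSTANCE** (p. 264: *"… by (2.38), C^{(k)}_Λ(u)^{−1} is bounded below and a random walk expansion as in [6] can be used to prove that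
|C^{(k)}_Λ(u; x₁, x₂)| ≦ ce^{−c|x₁−x₂|}. (2.41)"*).  For `2 ≤ d′ = d + 1 ≤ 3`, `L ≥ 3` odd, `a > 0`, `κ̂ > 0`, `M_max`: `∃ θ₀ ρ₀ δ₁ c₂ > 0` (from
`(d, L, a, κ̂, M_max)` only) such that on every torus of the series, at every level `1 ≤ k ≤ K` with `k + 1 ≤ m + K`, `2(L^k − 1) + 4 < |T^{(0)}|`,
`2(L − 1) + 4 < |T^{(k)}|`, for EVERY `U(1)` field `u` with `‖u(∂p) − 1‖ ≤ θ`, `0 ≤ θ`, `(L^{2k}θ)² ≤ θ₀`, every reference no-wrap box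
`Ω₀ = c·L^k + Π_i[0, L^kM₀_i)` (`M₀_i ≥ 1`, shorter than the torus, torus gap `≥ R`), spacing `s_g ≥ 1`, half-width `W ≥ 2s_g/3 + R₀/2 + R`, radii
`R ≥ (10 + ρ₀)L^k`, `ρ₀L^k ≤ R₁ < R₀`, multiplicity `(⌊(L^k − 1 + R₀)/s_g⌋ + 3)^{d+1} ≤ M_max`, and every `Λ` of `k`-sites whose blocks lie in `Ω₀` with
chart margin `R₀ + R`: **`‖C^{(k)}_Λ(u; x₁, x₂)‖ ≤ (A/a_k)^{−1}·c₂·e^{−δ₁|x₁−x₂|_{T^{(k)}}}`** for all `x₁, x₂ ∈ Λ` (`C^{(k)}_Λ(u) = [(Δ_{k,loc}(u) +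
(A/a_k)κ̂P(u_k))|_Λ]^{−1}`) — `decay241_smallPlaquette_torus_cwt_gauge` with its `hE`/`hsmall` discharged by the thresholds (gen 21's
`BIJ88Decay241RegularTorusCwtUniform` arithmetic). [cite: BalabanImbrieJaffe1988, (2.41) p.264] -/
theorem decay241_smallPlaquette_torus_cwt_uniform (d L : ℕ) (hd1 : 1 ≤ d) (hd3 : d + 1 ≤ 3) (hL : 3 ≤ L) (hodd : Odd L) {a : ℝ} (ha : 0 < a)
    {κ' : ℝ} (hκ' : 0 < κ') (Mmax : ℕ) :
    ∃ θ₀ ρ₀ δ₁ c₂ : ℝ, 0 < θ₀ ∧ 0 < ρ₀ ∧ 0 < δ₁ ∧ 0 < c₂ ∧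
      ∀ (P : Params) (hPd : P.d = d + 1), P.L = L →
      ∀ (k : ℕ), 1 ≤ k → k ≤ P.K → k + 1 ≤ P.m + P.K → 2 * (P.L ^ k - 1) + 4 < P.sitesPerDir 0 → 2 * (P.L - 1) + 4 < P.sitesPerDir (0 + k) →
      ∀ (U : GaugeField P 0 U1) (θ : ℝ), 0 ≤ θ → (∀ (y : Balaban1983to89.Site P 0) (μ ν : Fin P.d), ‖plaqC U y μ ν - 1‖ ≤ θ) →
        (((P.L : ℝ) ^ k) ^ 2 * θ) ^ 2 ≤ θ₀ →
      ∀ (c M0 : Fin (d + 1) → ℕ), (∀ i, 1 ≤ M0 i) → (∀ i, c i * P.L ^ k + P.L ^ k * M0 i ≤ P.sitesPerDir 0) →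
        (∀ i, P.L ^ k * M0 i < P.sitesPerDir 0) →
      ∀ (sg W : ℕ), 1 ≤ sg → ∀ (R R₀ R₁ : ℝ), (10 + ρ₀) * (P.L : ℝ) ^ k ≤ R → ρ₀ * (P.L : ℝ) ^ k ≤ R₁ → R₁ < R₀ →
        ((⌊(((P.L : ℝ) ^ k) - 1 + R₀) / sg⌋₊ + 3) ^ (d + 1) ≤ Mmax) →
        2 * (sg : ℝ) / 3 + R₀ / 2 + R ≤ W → (∀ i, ((P.L ^ k * M0 i : ℕ) : ℝ) + R ≤ P.sitesPerDir 0) →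
      ∀ (Λ : Finset (Balaban1983to89.Site P (0 + k))),
        (∀ y₁ ∈ Λ, ∀ μ, (c (Fin.cast hPd μ) : ℝ) * P.L ^ k + (R₀ + R) ≤ (P.L : ℝ) ^ k * (y₁ μ).val ∧
          (P.L : ℝ) ^ k * (y₁ μ).val + P.L ^ k + (R₀ + R) ≤ (c (Fin.cast hPd μ) : ℝ) * P.L ^ k + (P.L : ℝ) ^ k * M0 (Fin.cast hPd μ)) →
      ∀ (x₁ x₂ : ↥Λ),
        ‖(compress Λ (op240 (deltaLocT (B1RG242Torus.α P a k * (P.L : ℝ) ^ (k * P.d)) P.eps⁻¹ U k (cubeFam hPd (P.L ^ k) c M0 sg W)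
            (lamFam hPd (P.L ^ k) c M0 sg) (cutoff R₁ R₀ (B5Ineq137Torus.T P 0)))
            ((B1RG242Torus.α P a k * (P.L : ℝ) ^ (k * P.d)) / B1.aSeq a P.L k * κ') (lineIter U k)))⁻¹ x₁ x₂‖ ≤
          ((B1RG242Torus.α P a k * (P.L : ℝ) ^ (k * P.d)) / B1.aSeq a P.L k)⁻¹ * c₂ *
            Real.exp (-(δ₁ * B5Ineq137Torus.T P (0 + k) x₁ x₂)) := by
  have hL1 : L - 1 + 1 = L := Nat.sub_add_cancel (by omega)
  obtain ⟨δ₀, c₀, hδ₀0, hc₀, M⟩ := decay241_smallPlaquette_torus_cwt_gauge d (L - 1) hd1 hd3 (by omega) (by rw [hL1]; exact hodd) ha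
  have hLr3 : (3 : ℝ) ≤ L := by exact_mod_cast hL
  have hL0 : (0 : ℝ) < L := by linarith
  have hLL : (0 : ℝ) < 2 * (((L : ℝ) - 1) * L) := by nlinarith only [hLr3]
  -- the constants, as opaque abbreviations with their defining equations (functions of `(d, L, a, κ̂, M_max, δ₀, c₀)`)
  obtain ⟨g0, hg0⟩ : ∃ x : ℝ, x = min (a / (9 * ((d : ℝ) + 1 + 1))) (1 / 12) := ⟨_, rfl⟩
  have hg00 : 0 < g0 := by rw [hg0]; exact lt_min (by positivity) (by norm_num)
  obtain ⟨cS, hcS⟩ : ∃ x : ℝ, x = min (g0 / (2 * (((L : ℝ) - 1) * L))) (κ' / (2 * (L : ℝ) ^ (d + 1))) := ⟨_, rfl⟩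
  have hcS0 : 0 < cS := by rw [hcS]; exact lt_min (div_pos hg00 hLL) (by positivity)
  obtain ⟨K, hK⟩ : ∃ x : ℝ, x = latticeConst (d + 1) (δ₀ / 2) := ⟨_, rfl⟩
  have hK0 : 0 ≤ K := by rw [hK]; exact latticeConst_nonneg (d + 1) (half_pos hδ₀0).le
  obtain ⟨Zd, hZd⟩ : ∃ x : ℝ, x = 4 / 3 * ((d : ℝ) + 1) ^ 4 := ⟨_, rfl⟩
  have hZd0 : 0 ≤ Zd := by rw [hZd]; positivity
  obtain ⟨θ₀, hθ₀⟩ : ∃ x : ℝ, x = min (cS / (8 * (Zd + 1))) (min (1 / 500) ((1 / (4 * ((d : ℝ) + 1) ^ 2 * (L : ℝ) ^ 2)) ^ 2)) := ⟨_, rfl⟩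
  have hθ₀0 : 0 < θ₀ := by rw [hθ₀]; exact lt_min (by positivity) (lt_min (by norm_num) (by positivity))
  have hθ₀1 : θ₀ ≤ cS / (8 * (Zd + 1)) := by rw [hθ₀]; exact min_le_left _ _
  have hθ₀2 : θ₀ ≤ 1 / 500 := by rw [hθ₀]; exact (min_le_right _ _).trans (min_le_left _ _)
  have hθ₀3 : θ₀ ≤ (1 / (4 * ((d : ℝ) + 1) ^ 2 * (L : ℝ) ^ 2)) ^ 2 := by rw [hθ₀]; exact (min_le_right _ _).trans (min_le_right _ _)
  obtain ⟨B, hB⟩ : ∃ x : ℝ, x = a ^ 2 * (c₀ * Real.exp (δ₀ / 2) * K) * ((Mmax : ℝ) + 1) := ⟨_, rfl⟩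
  have hB0 : 0 ≤ B := by rw [hB]; positivity
  obtain ⟨η, hη⟩ : ∃ x : ℝ, x = cS / (8 * (B + 1)) := ⟨_, rfl⟩
  have hη0 : 0 < η := by rw [hη]; positivity
  obtain ⟨ρ₀, hρ₀⟩ : ∃ x : ℝ, x = 2 / δ₀ * (1 / η) := ⟨_, rfl⟩
  have hρ₀0 : 0 < ρ₀ := by rw [hρ₀]; positivity
  have h1η : 1 / η = δ₀ / 2 * ρ₀ := by rw [hρ₀]; field_simp
  obtain ⟨Wm, hWm⟩ : ∃ x : ℝ, x = 4 / δ₀ * (2 * K) *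
      (a * (1 + (Mmax : ℝ) * a * (c₀ * Real.exp δ₀)) + κ' * (((L : ℝ) ^ (d + 1))⁻¹) ^ 2 * Real.exp (δ₀ * ((L : ℝ) - 1))) := ⟨_, rfl⟩
  have hWm0 : 0 ≤ Wm := by rw [hWm]; positivity
  obtain ⟨ϑ, hϑ⟩ : ∃ x : ℝ, x = min (δ₀ / 4) (cS / (8 * (Wm + 1))) := ⟨_, rfl⟩
  have hϑ0 : 0 < ϑ := by rw [hϑ]; exact lt_min (by positivity) (by positivity)
  have hϑ4 : ϑ ≤ δ₀ / 4 := by rw [hϑ]; exact min_le_left _ _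
  have hϑW : ϑ ≤ cS / (8 * (Wm + 1)) := by rw [hϑ]; exact min_le_right _ _
  refine ⟨θ₀, ρ₀, ϑ, 16 / cS, hθ₀0, hρ₀0, hϑ0, by positivity, ?_⟩
  intro P hPd hPL k hk1 hkK hk' hbig hRk U θ hθ0 hθ hθθ c M0 hM0 hfit0 hN0 sg W hsg R R₀ R₁ hRρ hR₁ρ hR10 hMm hW hgap Λ hΛ x₁ x₂
  subst hPL
  have hdr : (P.d : ℝ) = (d : ℝ) + 1 := by rw [hPd]; push_cast; ring
  have hLk : (0 : ℝ) < (P.L : ℝ) ^ k := pow_pos hL0 k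
  have hρL : 0 < ρ₀ * (P.L : ℝ) ^ k := mul_pos hρ₀0 hLk
  have hRm : 10 * (P.L : ℝ) ^ k < R := by nlinarith only [hRρ, hρL]
  have hRρ' : ρ₀ * (P.L : ℝ) ^ k ≤ R := by nlinarith only [hRρ, hLk]
  have hR₁ : 0 ≤ R₁ := hρL.le.trans hR₁ρ
  -- the three plaquette thresholds folded in `θ₀`
  have hτ0 : 0 ≤ ((P.L : ℝ) ^ k) ^ 2 * θ := by positivity
  have hτ500 : (((P.L : ℝ) ^ k) ^ 2 * θ) ^ 2 ≤ 1 / 500 := hθθ.trans hθ₀2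
  have hτ2 : ((P.L : ℝ) ^ k) ^ 2 * θ ≤ 1 / (4 * (P.d : ℝ) ^ 2 * (P.L : ℝ) ^ 2) := by
    rw [hdr]
    exact (pow_le_pow_iff_left₀ hτ0 (by positivity) two_ne_zero).1 (hθθ.trans hθ₀3)
  -- normalization constants and the named pieces of the two numeric conditions
  have hak0 : 0 < B1.aSeq a P.L k := B1.aSeq_pos ha (B1RG242Torus.one_lt_cast_L P) hk1
  have hak_le : B1.aSeq a P.L k ≤ a := B1.aSeq_le ha (B1RG242Torus.one_lt_cast_L P) k hk1
  have hKP : latticeConst P.d (δ₀ / 2) = K := by rw [hK, hPd]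
  have hcSP : c240 P (min (a / (9 * (P.d + 1))) (1 / 12)) κ' = cS := by rw [c240, hcS, hg0, hdr, hPd]
  have hm : ((⌊(((P.L : ℝ) ^ k) - 1 + R₀) / sg⌋₊ : ℝ) + 3) ^ (d + 1) ≤ (Mmax : ℝ) := by exact_mod_cast hMm
  set m : ℝ := ((⌊(((P.L : ℝ) ^ k) - 1 + R₀) / sg⌋₊ : ℝ) + 3) ^ (d + 1) with hmdef
  have hm0 : 0 ≤ m := by rw [hmdef]; positivity
  -- the two exponential factors of the (2.35) bracket are `≤ η` (`R, R₁ ≥ ρ₀L^k`, `(δ₀/2)ρ₀ = 1/η`)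
  have hexp2 : Real.exp (-(δ₀ * (((P.L : ℝ) ^ k)⁻¹ * (2 * R)))) ≤ η := by
    refine exp_neg_le_of_inv_le hη0 ?_
    have h2 : ρ₀ ≤ ((P.L : ℝ) ^ k)⁻¹ * (2 * R) := by
      rw [inv_mul_eq_div, le_div_iff₀ hLk]; linarith only [hRρ', hρL]
    rw [h1η]
    have h3 := mul_le_mul_of_nonneg_left h2 hδ₀0.le
    linarith only [h3, mul_pos hδ₀0 hρ₀0]
  have hexp1 : Real.exp (-(δ₀ / 2 * (((P.L : ℝ) ^ k)⁻¹ * R₁))) ≤ η := by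
    refine exp_neg_le_of_inv_le hη0 ?_
    have h2 : ρ₀ ≤ ((P.L : ℝ) ^ k)⁻¹ * R₁ := by
      rw [inv_mul_eq_div, le_div_iff₀ hLk]; exact hR₁ρ
    rw [h1η]
    exact mul_le_mul_of_nonneg_left h2 (by positivity)
  -- the (2.35) bracket term `≤ cS/8`
  have hBr : B1.aSeq a P.L k ^ 2 * (c₀ * Real.exp (δ₀ / 2) * K) *
      (m * Real.exp (-(δ₀ * (((P.L : ℝ) ^ k)⁻¹ * (2 * R)))) + Real.exp (-(δ₀ / 2 * (((P.L : ℝ) ^ k)⁻¹ * R₁)))) ≤ cS / 8 := by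
    have h1 : B1.aSeq a P.L k ^ 2 ≤ a ^ 2 := pow_le_pow_left₀ hak0.le hak_le 2
    have h2 : m * Real.exp (-(δ₀ * (((P.L : ℝ) ^ k)⁻¹ * (2 * R)))) + Real.exp (-(δ₀ / 2 * (((P.L : ℝ) ^ k)⁻¹ * R₁))) ≤
        ((Mmax : ℝ) + 1) * η :=
      (add_le_add (mul_le_mul hm hexp2 (Real.exp_pos _).le (Nat.cast_nonneg _)) hexp1).trans_eq (by ring)
    have h3 : 0 ≤ c₀ * Real.exp (δ₀ / 2) * K := by positivity
    have h4 : 0 ≤ m * Real.exp (-(δ₀ * (((P.L : ℝ) ^ k)⁻¹ * (2 * R)))) + Real.exp (-(δ₀ / 2 * (((P.L : ℝ) ^ k)⁻¹ * R₁))) := by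
      positivity
    calc B1.aSeq a P.L k ^ 2 * (c₀ * Real.exp (δ₀ / 2) * K) *
          (m * Real.exp (-(δ₀ * (((P.L : ℝ) ^ k)⁻¹ * (2 * R)))) + Real.exp (-(δ₀ / 2 * (((P.L : ℝ) ^ k)⁻¹ * R₁))))
        ≤ a ^ 2 * (c₀ * Real.exp (δ₀ / 2) * K) * (((Mmax : ℝ) + 1) * η) :=
          mul_le_mul (mul_le_mul_of_nonneg_right h1 h3) h2 h4 (by positivity)
      _ = B * η := by rw [hB]; ring
      _ ≤ cS / 8 := by
          rw [hη, mul_div_assoc', div_le_div_iff₀ (by positivity) (by norm_num : (0 : ℝ) < 8)]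
          have e8 : cS * (8 * (B + 1)) = B * cS * 8 + 8 * cS := by ring
          rw [e8]; linarith only [hcS0.le]
  -- the (7.3.2) term `≤ cS/8`
  have hEm : 4 / 3 * (P.d : ℝ) ^ 4 * (((P.L : ℝ) ^ k) ^ 2 * θ) ^ 2 ≤ cS / 8 := by
    rw [hdr, ← hZd]
    calc Zd * (((P.L : ℝ) ^ k) ^ 2 * θ) ^ 2 ≤ Zd * (cS / (8 * (Zd + 1))) := mul_le_mul_of_nonneg_left (hθθ.trans hθ₀1) hZd0
      _ ≤ cS / 8 := by
          rw [mul_div_assoc', div_le_div_iff₀ (by positivity) (by norm_num : (0 : ℝ) < 8)]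
          have e8 : cS * (8 * (Zd + 1)) = Zd * cS * 8 + 8 * cS := by ring
          rw [e8]; linarith only [hcS0.le]
  -- `hE` of the `_gauge` member (`σ = ½` built in)
  have hE : 4 / 3 * (P.d : ℝ) ^ 4 * (((P.L : ℝ) ^ k) ^ 2 * θ) ^ 2 +
      B1.aSeq a P.L k ^ 2 * (c₀ * Real.exp (δ₀ / 2) * latticeConst P.d (δ₀ / 2)) *
        (m * Real.exp (-(δ₀ * (((P.L : ℝ) ^ k)⁻¹ * (2 * R)))) + Real.exp (-(δ₀ / 2 * (((P.L : ℝ) ^ k)⁻¹ * R₁)))) <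
      c240 P (min (a / (9 * (P.d + 1))) (1 / 12)) κ' * (1 - 1 / 2) := by
    rw [hKP, hcSP]; linarith only [hBr, hEm, hcS0]
  -- the walk-expansion weight `≤ W_max` and `hsmall`
  have hWle : 4 / δ₀ * (2 * K) * (B1.aSeq a P.L k * (1 + m * B1.aSeq a P.L k * (c₀ * Real.exp δ₀)) +
      κ' * (((P.L : ℝ) ^ P.d)⁻¹) ^ 2 * Real.exp (δ₀ * ((P.L : ℝ) - 1))) ≤ Wm := by
    rw [hWm, hPd]
    have h11 : m * B1.aSeq a P.L k ≤ (Mmax : ℝ) * a := mul_le_mul hm hak_le hak0.le (Nat.cast_nonneg _)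
    have h12 : 0 ≤ 1 + m * B1.aSeq a P.L k * (c₀ * Real.exp δ₀) := by positivity
    have h1 : B1.aSeq a P.L k * (1 + m * B1.aSeq a P.L k * (c₀ * Real.exp δ₀)) ≤ a * (1 + (Mmax : ℝ) * a * (c₀ * Real.exp δ₀)) :=
      calc B1.aSeq a P.L k * (1 + m * B1.aSeq a P.L k * (c₀ * Real.exp δ₀))
          ≤ a * (1 + m * B1.aSeq a P.L k * (c₀ * Real.exp δ₀)) := mul_le_mul_of_nonneg_right hak_le h12
        _ ≤ a * (1 + (Mmax : ℝ) * a * (c₀ * Real.exp δ₀)) := by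
            refine mul_le_mul_of_nonneg_left ?_ ha.le
            have := mul_le_mul_of_nonneg_right h11 (show 0 ≤ c₀ * Real.exp δ₀ by positivity)
            linarith only [this]
    exact mul_le_mul_of_nonneg_left (add_le_add h1 le_rfl) (by positivity)
  have hsmall : ϑ * ((4 / δ₀) * (2 * latticeConst P.d (δ₀ / 2)) *
      (B1.aSeq a P.L k * (1 + m * B1.aSeq a P.L k * (c₀ * Real.exp δ₀)) +
        κ' * (((P.L : ℝ) ^ P.d)⁻¹) ^ 2 * Real.exp (δ₀ * ((P.L : ℝ) - 1)))) ≤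
      (c240 P (min (a / (9 * (P.d + 1))) (1 / 12)) κ' * (1 - 1 / 2) -
        (4 / 3 * (P.d : ℝ) ^ 4 * (((P.L : ℝ) ^ k) ^ 2 * θ) ^ 2 +
          B1.aSeq a P.L k ^ 2 * (c₀ * Real.exp (δ₀ / 2) * latticeConst P.d (δ₀ / 2)) *
            (m * Real.exp (-(δ₀ * (((P.L : ℝ) ^ k)⁻¹ * (2 * R)))) + Real.exp (-(δ₀ / 2 * (((P.L : ℝ) ^ k)⁻¹ * R₁)))))) / 2 := by
    have h1 : ϑ * Wm ≤ cS / 8 := by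
      calc ϑ * Wm ≤ cS / (8 * (Wm + 1)) * Wm := mul_le_mul_of_nonneg_right hϑW hWm0
        _ ≤ cS / 8 := by
            rw [div_mul_eq_mul_div, div_le_div_iff₀ (by positivity) (by norm_num : (0 : ℝ) < 8)]
            have e8 : cS * (8 * (Wm + 1)) = cS * Wm * 8 + 8 * cS := by ring
            rw [e8]; linarith only [hcS0.le]
    have h2 := mul_le_mul_of_nonneg_left hWle hϑ0.le
    rw [hKP, hcSP]
    linarith only [h1, h2, hBr, hEm]
  -- the `_gauge` member at `κ′ = κ̂`, and the final constant `4/(c_S/2 − E) ≤ 16/c_S`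
  have hmain := M P hPd hL1.symm k hk1 hkK hk' hbig U θ hθ0 hθ hτ500 c M0 hM0 hfit0 hN0 sg W hsg R R₀ R₁ hRm hR₁ hR10 hW hgap Λ hΛ hτ2 hRk
    κ' hκ'.le hE ϑ hϑ0.le hϑ4 hsmall x₁ x₂
  refine hmain.trans ?_
  have he0 : 0 ≤ Real.exp (-(ϑ * B5Ineq137Torus.T P (0 + k) x₁ x₂)) := (Real.exp_pos _).le
  have hα : 0 < B1RG242Torus.α P a k := mul_pos hak0 (inv_pos.mpr (pow_pos (P.spacing_pos k) 2))
  have hA0 : 0 ≤ ((B1RG242Torus.α P a k * (P.L : ℝ) ^ (k * P.d)) / B1.aSeq a P.L k)⁻¹ :=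
    (inv_pos.2 (div_pos (mul_pos hα (pow_pos P.cast_L_pos _)) hak0)).le
  have hc : 4 / (c240 P (min (a / (9 * (P.d + 1))) (1 / 12)) κ' * (1 - 1 / 2) -
      (4 / 3 * (P.d : ℝ) ^ 4 * (((P.L : ℝ) ^ k) ^ 2 * θ) ^ 2 +
        B1.aSeq a P.L k ^ 2 * (c₀ * Real.exp (δ₀ / 2) * latticeConst P.d (δ₀ / 2)) *
          (m * Real.exp (-(δ₀ * (((P.L : ℝ) ^ k)⁻¹ * (2 * R)))) + Real.exp (-(δ₀ / 2 * (((P.L : ℝ) ^ k)⁻¹ * R₁)))))) ≤ 16 / cS := by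
    rw [hKP, hcSP]
    have hgap' : cS / 4 ≤ cS * (1 - 1 / 2) - (4 / 3 * (P.d : ℝ) ^ 4 * (((P.L : ℝ) ^ k) ^ 2 * θ) ^ 2 +
        B1.aSeq a P.L k ^ 2 * (c₀ * Real.exp (δ₀ / 2) * K) *
          (m * Real.exp (-(δ₀ * (((P.L : ℝ) ^ k)⁻¹ * (2 * R)))) + Real.exp (-(δ₀ / 2 * (((P.L : ℝ) ^ k)⁻¹ * R₁))))) := by
      linarith only [hBr, hEm]
    calc _ ≤ 4 / (cS / 4) := div_le_div_of_nonneg_left (by norm_num) (by positivity) hgap'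
      _ = 16 / cS := by rw [div_div_eq_mul_div]; ring
  exact mul_le_mul_of_nonneg_right (mul_le_mul_of_nonneg_left hc hA0) he0

/-- **(2.40) AND (4.9)_{j≥1} FOR `Δ_{k,loc}(u)` AT A GENERAL SMALL-PLAQUETTE `U(1)` FIELD, `Ω = T_η`, PRINTED TORUS DATA — NO GAUGE CONDITION, CONSTANTS
CHOSEN BEFORE THE INSTANCE** (p. 264: *"We define C^{(k)}_Λ(u) = […]^{−1}. (2.40) … by (2.38), C^{(k)}_Λ(u)^{−1} is bounded below"*; p. 275 (4.9)):
`∃ θ₀ ρ₀ > 0` (from `(d, L, a, κ̂, M_max)` only) such that, under the data of `decay241_smallPlaquette_torus_cwt_uniform` (torus, level, `u` with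
`‖u(∂p) − 1‖ ≤ θ`, `(L^{2k}θ)² ≤ θ₀`, reference box, `s_g ≥ 1`, `W`, radii `R ≥ (10 + ρ₀)L^k`, `ρ₀L^k ≤ R₁ < R₀`, multiplicity `≤ M_max`, deep `Λ`),
for all `E_s, N`: `realify((Δ_{k,loc}(u) + (A/a_k)κ̂P(u_k))|_Λ)` IS POSITIVE DEFINITE, `Z^{(k)}_Λ = e^{−E_sN}(2π)^{#(Λ×2)/2}/√det(…)` and
`Z^{(k)}_Λ > 0` — `Z49_smallPlaquette_torus_cwt_gauge` with its `hE` discharged. [cite: BalabanImbrieJaffe1988, (2.40) p.264]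
[cite: BalabanImbrieJaffe1988, (4.9) p.275] -/
theorem Z49_smallPlaquette_torus_cwt_uniform (d L : ℕ) (hd1 : 1 ≤ d) (hd3 : d + 1 ≤ 3) (hL : 3 ≤ L) (hodd : Odd L) {a : ℝ} (ha : 0 < a)
    {κ' : ℝ} (hκ' : 0 < κ') (Mmax : ℕ) :
    ∃ θ₀ ρ₀ : ℝ, 0 < θ₀ ∧ 0 < ρ₀ ∧
      ∀ (P : Params) (hPd : P.d = d + 1), P.L = L →
      ∀ (k : ℕ), 1 ≤ k → k ≤ P.K → k + 1 ≤ P.m + P.K → 2 * (P.L ^ k - 1) + 4 < P.sitesPerDir 0 → 2 * (P.L - 1) + 4 < P.sitesPerDir (0 + k) →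
      ∀ (U : GaugeField P 0 U1) (θ : ℝ), 0 ≤ θ → (∀ (y : Balaban1983to89.Site P 0) (μ ν : Fin P.d), ‖plaqC U y μ ν - 1‖ ≤ θ) →
        (((P.L : ℝ) ^ k) ^ 2 * θ) ^ 2 ≤ θ₀ →
      ∀ (c M0 : Fin (d + 1) → ℕ), (∀ i, 1 ≤ M0 i) → (∀ i, c i * P.L ^ k + P.L ^ k * M0 i ≤ P.sitesPerDir 0) →
        (∀ i, P.L ^ k * M0 i < P.sitesPerDir 0) →
      ∀ (sg W : ℕ), 1 ≤ sg → ∀ (R R₀ R₁ : ℝ), (10 + ρ₀) * (P.L : ℝ) ^ k ≤ R → ρ₀ * (P.L : ℝ) ^ k ≤ R₁ → R₁ < R₀ →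
        ((⌊(((P.L : ℝ) ^ k) - 1 + R₀) / sg⌋₊ + 3) ^ (d + 1) ≤ Mmax) →
        2 * (sg : ℝ) / 3 + R₀ / 2 + R ≤ W → (∀ i, ((P.L ^ k * M0 i : ℕ) : ℝ) + R ≤ P.sitesPerDir 0) →
      ∀ (Λ : Finset (Balaban1983to89.Site P (0 + k))),
        (∀ y₁ ∈ Λ, ∀ μ, (c (Fin.cast hPd μ) : ℝ) * P.L ^ k + (R₀ + R) ≤ (P.L : ℝ) ^ k * (y₁ μ).val ∧
          (P.L : ℝ) ^ k * (y₁ μ).val + P.L ^ k + (R₀ + R) ≤ (c (Fin.cast hPd μ) : ℝ) * P.L ^ k + (P.L : ℝ) ^ k * M0 (Fin.cast hPd μ)) →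
      ∀ (Es N : ℝ),
        (realify (compress Λ (op240 (deltaLocT (B1RG242Torus.α P a k * (P.L : ℝ) ^ (k * P.d)) P.eps⁻¹ U k (cubeFam hPd (P.L ^ k) c M0 sg W)
            (lamFam hPd (P.L ^ k) c M0 sg) (cutoff R₁ R₀ (B5Ineq137Torus.T P 0)))
            ((B1RG242Torus.α P a k * (P.L : ℝ) ^ (k * P.d)) / B1.aSeq a P.L k * κ') (lineIter U k)))).PosDef ∧
        Z49 (realify (compress Λ (op240 (deltaLocT (B1RG242Torus.α P a k * (P.L : ℝ) ^ (k * P.d)) P.eps⁻¹ U k (cubeFam hPd (P.L ^ k) c M0 sg W)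
            (lamFam hPd (P.L ^ k) c M0 sg) (cutoff R₁ R₀ (B5Ineq137Torus.T P 0)))
            ((B1RG242Torus.α P a k * (P.L : ℝ) ^ (k * P.d)) / B1.aSeq a P.L k * κ') (lineIter U k)))) Es N =
          Real.exp (-(Es * N)) * (Real.sqrt (2 * Real.pi) ^ Fintype.card (↥Λ × Fin 2) /
            Real.sqrt (realify (compress Λ (op240 (deltaLocT (B1RG242Torus.α P a k * (P.L : ℝ) ^ (k * P.d)) P.eps⁻¹ U k (cubeFam hPd (P.L ^ k) c M0 sg W)
            (lamFam hPd (P.L ^ k) c M0 sg) (cutoff R₁ R₀ (B5Ineq137Torus.T P 0)))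
            ((B1RG242Torus.α P a k * (P.L : ℝ) ^ (k * P.d)) / B1.aSeq a P.L k * κ') (lineIter U k)))).det) ∧
        0 < Z49 (realify (compress Λ (op240 (deltaLocT (B1RG242Torus.α P a k * (P.L : ℝ) ^ (k * P.d)) P.eps⁻¹ U k (cubeFam hPd (P.L ^ k) c M0 sg W)
            (lamFam hPd (P.L ^ k) c M0 sg) (cutoff R₁ R₀ (B5Ineq137Torus.T P 0)))
            ((B1RG242Torus.α P a k * (P.L : ℝ) ^ (k * P.d)) / B1.aSeq a P.L k * κ') (lineIter U k)))) Es N := by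
  have hL1 : L - 1 + 1 = L := Nat.sub_add_cancel (by omega)
  obtain ⟨δ₀, c₀, hδ₀0, hc₀, M⟩ := Z49_smallPlaquette_torus_cwt_gauge d (L - 1) hd1 hd3 (by omega) (by rw [hL1]; exact hodd) ha
  have hLr3 : (3 : ℝ) ≤ L := by exact_mod_cast hL
  have hL0 : (0 : ℝ) < L := by linarith
  have hLL : (0 : ℝ) < 2 * (((L : ℝ) - 1) * L) := by nlinarith only [hLr3]
  -- the constants, as opaque abbreviations with their defining equations (functions of `(d, L, a, κ̂, M_max, δ₀, c₀)`)
  obtain ⟨g0, hg0⟩ : ∃ x : ℝ, x = min (a / (9 * ((d : ℝ) + 1 + 1))) (1 / 12) := ⟨_, rfl⟩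
  have hg00 : 0 < g0 := by rw [hg0]; exact lt_min (by positivity) (by norm_num)
  obtain ⟨cS, hcS⟩ : ∃ x : ℝ, x = min (g0 / (2 * (((L : ℝ) - 1) * L))) (κ' / (2 * (L : ℝ) ^ (d + 1))) := ⟨_, rfl⟩
  have hcS0 : 0 < cS := by rw [hcS]; exact lt_min (div_pos hg00 hLL) (by positivity)
  obtain ⟨K, hK⟩ : ∃ x : ℝ, x = latticeConst (d + 1) (δ₀ / 2) := ⟨_, rfl⟩
  have hK0 : 0 ≤ K := by rw [hK]; exact latticeConst_nonneg (d + 1) (half_pos hδ₀0).le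
  obtain ⟨Zd, hZd⟩ : ∃ x : ℝ, x = 4 / 3 * ((d : ℝ) + 1) ^ 4 := ⟨_, rfl⟩
  have hZd0 : 0 ≤ Zd := by rw [hZd]; positivity
  obtain ⟨θ₀, hθ₀⟩ : ∃ x : ℝ, x = min (cS / (8 * (Zd + 1))) (min (1 / 500) ((1 / (4 * ((d : ℝ) + 1) ^ 2 * (L : ℝ) ^ 2)) ^ 2)) := ⟨_, rfl⟩
  have hθ₀0 : 0 < θ₀ := by rw [hθ₀]; exact lt_min (by positivity) (lt_min (by norm_num) (by positivity))
  have hθ₀1 : θ₀ ≤ cS / (8 * (Zd + 1)) := by rw [hθ₀]; exact min_le_left _ _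
  have hθ₀2 : θ₀ ≤ 1 / 500 := by rw [hθ₀]; exact (min_le_right _ _).trans (min_le_left _ _)
  have hθ₀3 : θ₀ ≤ (1 / (4 * ((d : ℝ) + 1) ^ 2 * (L : ℝ) ^ 2)) ^ 2 := by rw [hθ₀]; exact (min_le_right _ _).trans (min_le_right _ _)
  obtain ⟨B, hB⟩ : ∃ x : ℝ, x = a ^ 2 * (c₀ * Real.exp (δ₀ / 2) * K) * ((Mmax : ℝ) + 1) := ⟨_, rfl⟩
  have hB0 : 0 ≤ B := by rw [hB]; positivity
  obtain ⟨η, hη⟩ : ∃ x : ℝ, x = cS / (8 * (B + 1)) := ⟨_, rfl⟩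
  have hη0 : 0 < η := by rw [hη]; positivity
  obtain ⟨ρ₀, hρ₀⟩ : ∃ x : ℝ, x = 2 / δ₀ * (1 / η) := ⟨_, rfl⟩
  have hρ₀0 : 0 < ρ₀ := by rw [hρ₀]; positivity
  have h1η : 1 / η = δ₀ / 2 * ρ₀ := by rw [hρ₀]; field_simp
  refine ⟨θ₀, ρ₀, hθ₀0, hρ₀0, ?_⟩
  intro P hPd hPL k hk1 hkK hk' hbig hRk U θ hθ0 hθ hθθ c M0 hM0 hfit0 hN0 sg W hsg R R₀ R₁ hRρ hR₁ρ hR10 hMm hW hgap Λ hΛ Es N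
  subst hPL
  have hdr : (P.d : ℝ) = (d : ℝ) + 1 := by rw [hPd]; push_cast; ring
  have hLk : (0 : ℝ) < (P.L : ℝ) ^ k := pow_pos hL0 k
  have hρL : 0 < ρ₀ * (P.L : ℝ) ^ k := mul_pos hρ₀0 hLk
  have hRm : 10 * (P.L : ℝ) ^ k < R := by nlinarith only [hRρ, hρL]
  have hRρ' : ρ₀ * (P.L : ℝ) ^ k ≤ R := by nlinarith only [hRρ, hLk]
  have hR₁ : 0 ≤ R₁ := hρL.le.trans hR₁ρ
  -- the three plaquette thresholds folded in `θ₀`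
  have hτ0 : 0 ≤ ((P.L : ℝ) ^ k) ^ 2 * θ := by positivity
  have hτ500 : (((P.L : ℝ) ^ k) ^ 2 * θ) ^ 2 ≤ 1 / 500 := hθθ.trans hθ₀2
  have hτ2 : ((P.L : ℝ) ^ k) ^ 2 * θ ≤ 1 / (4 * (P.d : ℝ) ^ 2 * (P.L : ℝ) ^ 2) := by
    rw [hdr]
    exact (pow_le_pow_iff_left₀ hτ0 (by positivity) two_ne_zero).1 (hθθ.trans hθ₀3)
  -- normalization constants and the named pieces of the two numeric conditions
  have hak0 : 0 < B1.aSeq a P.L k := B1.aSeq_pos ha (B1RG242Torus.one_lt_cast_L P) hk1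
  have hak_le : B1.aSeq a P.L k ≤ a := B1.aSeq_le ha (B1RG242Torus.one_lt_cast_L P) k hk1
  have hKP : latticeConst P.d (δ₀ / 2) = K := by rw [hK, hPd]
  have hcSP : c240 P (min (a / (9 * (P.d + 1))) (1 / 12)) κ' = cS := by rw [c240, hcS, hg0, hdr, hPd]
  have hm : ((⌊(((P.L : ℝ) ^ k) - 1 + R₀) / sg⌋₊ : ℝ) + 3) ^ (d + 1) ≤ (Mmax : ℝ) := by exact_mod_cast hMm
  set m : ℝ := ((⌊(((P.L : ℝ) ^ k) - 1 + R₀) / sg⌋₊ : ℝ) + 3) ^ (d + 1) with hmdef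
  have hm0 : 0 ≤ m := by rw [hmdef]; positivity
  -- the two exponential factors of the (2.35) bracket are `≤ η` (`R, R₁ ≥ ρ₀L^k`, `(δ₀/2)ρ₀ = 1/η`)
  have hexp2 : Real.exp (-(δ₀ * (((P.L : ℝ) ^ k)⁻¹ * (2 * R)))) ≤ η := by
    refine exp_neg_le_of_inv_le hη0 ?_
    have h2 : ρ₀ ≤ ((P.L : ℝ) ^ k)⁻¹ * (2 * R) := by
      rw [inv_mul_eq_div, le_div_iff₀ hLk]; linarith only [hRρ', hρL]
    rw [h1η]
    have h3 := mul_le_mul_of_nonneg_left h2 hδ₀0.le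
    linarith only [h3, mul_pos hδ₀0 hρ₀0]
  have hexp1 : Real.exp (-(δ₀ / 2 * (((P.L : ℝ) ^ k)⁻¹ * R₁))) ≤ η := by
    refine exp_neg_le_of_inv_le hη0 ?_
    have h2 : ρ₀ ≤ ((P.L : ℝ) ^ k)⁻¹ * R₁ := by
      rw [inv_mul_eq_div, le_div_iff₀ hLk]; exact hR₁ρ
    rw [h1η]
    exact mul_le_mul_of_nonneg_left h2 (by positivity)
  -- the (2.35) bracket term `≤ cS/8`
  have hBr : B1.aSeq a P.L k ^ 2 * (c₀ * Real.exp (δ₀ / 2) * K) *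
      (m * Real.exp (-(δ₀ * (((P.L : ℝ) ^ k)⁻¹ * (2 * R)))) + Real.exp (-(δ₀ / 2 * (((P.L : ℝ) ^ k)⁻¹ * R₁)))) ≤ cS / 8 := by
    have h1 : B1.aSeq a P.L k ^ 2 ≤ a ^ 2 := pow_le_pow_left₀ hak0.le hak_le 2
    have h2 : m * Real.exp (-(δ₀ * (((P.L : ℝ) ^ k)⁻¹ * (2 * R)))) + Real.exp (-(δ₀ / 2 * (((P.L : ℝ) ^ k)⁻¹ * R₁))) ≤
        ((Mmax : ℝ) + 1) * η :=
      (add_le_add (mul_le_mul hm hexp2 (Real.exp_pos _).le (Nat.cast_nonneg _)) hexp1).trans_eq (by ring)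
    have h3 : 0 ≤ c₀ * Real.exp (δ₀ / 2) * K := by positivity
    have h4 : 0 ≤ m * Real.exp (-(δ₀ * (((P.L : ℝ) ^ k)⁻¹ * (2 * R)))) + Real.exp (-(δ₀ / 2 * (((P.L : ℝ) ^ k)⁻¹ * R₁))) := by
      positivity
    calc B1.aSeq a P.L k ^ 2 * (c₀ * Real.exp (δ₀ / 2) * K) *
          (m * Real.exp (-(δ₀ * (((P.L : ℝ) ^ k)⁻¹ * (2 * R)))) + Real.exp (-(δ₀ / 2 * (((P.L : ℝ) ^ k)⁻¹ * R₁))))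
        ≤ a ^ 2 * (c₀ * Real.exp (δ₀ / 2) * K) * (((Mmax : ℝ) + 1) * η) :=
          mul_le_mul (mul_le_mul_of_nonneg_right h1 h3) h2 h4 (by positivity)
      _ = B * η := by rw [hB]; ring
      _ ≤ cS / 8 := by
          rw [hη, mul_div_assoc', div_le_div_iff₀ (by positivity) (by norm_num : (0 : ℝ) < 8)]
          have e8 : cS * (8 * (B + 1)) = B * cS * 8 + 8 * cS := by ring
          rw [e8]; linarith only [hcS0.le]
  -- the (7.3.2) term `≤ cS/8`
  have hEm : 4 / 3 * (P.d : ℝ) ^ 4 * (((P.L : ℝ) ^ k) ^ 2 * θ) ^ 2 ≤ cS / 8 := by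
    rw [hdr, ← hZd]
    calc Zd * (((P.L : ℝ) ^ k) ^ 2 * θ) ^ 2 ≤ Zd * (cS / (8 * (Zd + 1))) := mul_le_mul_of_nonneg_left (hθθ.trans hθ₀1) hZd0
      _ ≤ cS / 8 := by
          rw [mul_div_assoc', div_le_div_iff₀ (by positivity) (by norm_num : (0 : ℝ) < 8)]
          have e8 : cS * (8 * (Zd + 1)) = Zd * cS * 8 + 8 * cS := by ring
          rw [e8]; linarith only [hcS0.le]
  -- `hE` of the `_gauge` member (`σ = ½` built in)
  have hE : 4 / 3 * (P.d : ℝ) ^ 4 * (((P.L : ℝ) ^ k) ^ 2 * θ) ^ 2 +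
      B1.aSeq a P.L k ^ 2 * (c₀ * Real.exp (δ₀ / 2) * latticeConst P.d (δ₀ / 2)) *
        (m * Real.exp (-(δ₀ * (((P.L : ℝ) ^ k)⁻¹ * (2 * R)))) + Real.exp (-(δ₀ / 2 * (((P.L : ℝ) ^ k)⁻¹ * R₁)))) <
      c240 P (min (a / (9 * (P.d + 1))) (1 / 12)) κ' * (1 - 1 / 2) := by
    rw [hKP, hcSP]; linarith only [hBr, hEm, hcS0]
  exact M P hPd hL1.symm k hk1 hkK hk' hbig U θ hθ0 hθ hτ500 c M0 hM0 hfit0 hN0 sg W hsg R R₀ R₁ hRm hR₁ hR10 hW hgap Λ hΛ hτ2 hRk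
    κ' hκ'.le hE Es N

end Uniform

/-! ## §5 (v1.1) Non-vacuity: the hypotheses of the constants-before-the-instance (2.41) member are jointly satisfiable -/

section Instance

open BIJ85CovariantHiggsDictionary (expGauge)
open BIJ88Decay241RegularTorusCwt (norm_plaqC_expGauge_sub_one_le)

/-- **THE HYPOTHESES OF `decay241_smallPlaquette_torus_cwt_uniform` ARE JOINTLY SATISFIABLE — THRESHOLDS INCLUDED** (so the constants-before-
the-instance (2.41) bound is not a statement about the empty set): for every `(a, κ̂)` the theorem yields `θ₀ ρ₀ δ₁ c₂` (here with `d′ = 2`, `L = 3`,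
`M_max = 9`), and — chosen AFTER them — the torus `(ℤ/2·3^{m+1})²` (`m` with `3^m > 3M_b + R + 9`), the level `k = 1`, the background
`u = e^{i·0·εA} = 1` (`θ = 0`), the reference box `Ω₀ = [0, 3M_b)²` (`c = 0`, `M_b = 2v + 2`, `v = ⌈(R₀ + R)/3⌉ + 1`), the spacing
`s_g = ⌈2 + R₀⌉ + 1` (so the multiplicity is `(0 + 3)² = 9`), the half-width `W = ⌈2s_g/3 + R₀/2 + R⌉`, the radii `R = 3(10 + ρ₀)`, `R₁ = 3ρ₀`,
`R₀ = 3ρ₀ + 1` and `Λ = {y₁}`, `y₁ ≡ v` (its block at chart depth `≥ R₀ + R` in `Ω₀`) meet EVERY displayed hypothesis (no-wrap conditions, fit and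
torus gap of `Ω₀`, radii and multiplicity thresholds, depth window); consequently the (2.41) bound holds there.  (The instance background is flat;
since `θ₀ > 0`, every `u` with `(L^{2k}θ)² ≤ θ₀` on the same data qualifies equally.) [cite: BalabanImbrieJaffe1988, (2.41) p.264] -/
theorem decay241_smallPlaquette_torus_cwt_uniform_nonvacuous {a : ℝ} (ha : 0 < a) {κ' : ℝ} (hκ' : 0 < κ') :
    ∃ θ₀ ρ₀ δ₁ c₂ : ℝ, 0 < θ₀ ∧ 0 < ρ₀ ∧ 0 < δ₁ ∧ 0 < c₂ ∧
    ∃ (P : Params) (hPd : P.d = 1 + 1), P.L = 3 ∧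
    ∃ (Mb sg W : ℕ) (R R₀ R₁ : ℝ) (y₁ : Balaban1983to89.Site P (0 + 1)), 10 * (3 : ℝ) < R ∧ 0 ≤ R₁ ∧ R₁ < R₀ ∧
      ∀ (x₁ x₂ : ↥({y₁} : Finset (Balaban1983to89.Site P (0 + 1)))),
        ‖(compress {y₁} (op240 (deltaLocT (B1RG242Torus.α P a 1 * (P.L : ℝ) ^ (1 * P.d)) P.eps⁻¹ (expGauge P 0 fun _ => 0) 1
            (cubeFam hPd (P.L ^ 1) (fun _ => 0) (fun _ => Mb) sg W) (lamFam hPd (P.L ^ 1) (fun _ => 0) (fun _ => Mb) sg)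
            (cutoff R₁ R₀ (B5Ineq137Torus.T P 0)))
            ((B1RG242Torus.α P a 1 * (P.L : ℝ) ^ (1 * P.d)) / B1.aSeq a P.L 1 * κ') (lineIter (expGauge P 0 fun _ => 0) 1)))⁻¹ x₁ x₂‖ ≤
          ((B1RG242Torus.α P a 1 * (P.L : ℝ) ^ (1 * P.d)) / B1.aSeq a P.L 1)⁻¹ * c₂ *
            Real.exp (-(δ₁ * B5Ineq137Torus.T P (0 + 1) x₁ x₂)) := by
  obtain ⟨θ₀, ρ₀, δ₁, c₂, hθ₀, hρ₀, hδ₁, hc₂, M⟩ :=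
    decay241_smallPlaquette_torus_cwt_uniform 1 3 le_rfl (by norm_num) le_rfl ⟨1, by norm_num⟩ ha hκ' 9
  refine ⟨θ₀, ρ₀, δ₁, c₂, hθ₀, hρ₀, hδ₁, hc₂, ?_⟩
  -- radii, spacing, half-width, the deep `k`-site index and the box side, all functions of `ρ₀`
  obtain ⟨R₁, hR₁⟩ : ∃ x : ℝ, x = ρ₀ * 3 := ⟨_, rfl⟩
  obtain ⟨R₀, hR₀⟩ : ∃ x : ℝ, x = ρ₀ * 3 + 1 := ⟨_, rfl⟩
  obtain ⟨R, hR⟩ : ∃ x : ℝ, x = (10 + ρ₀) * 3 := ⟨_, rfl⟩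
  have hR0 : 0 ≤ R := by rw [hR]; positivity
  have hR₁0 : 0 ≤ R₁ := by rw [hR₁]; positivity
  have hR10 : R₁ < R₀ := by rw [hR₁, hR₀]; linarith
  have hR₀0 : 0 ≤ R₀ := by linarith
  obtain ⟨sg, hsg⟩ : ∃ n : ℕ, n = ⌈2 + R₀⌉₊ + 1 := ⟨_, rfl⟩
  have hsg1 : 1 ≤ sg := by rw [hsg]; omega
  have hsgR : 2 + R₀ < sg := by
    rw [hsg]; push_cast; linarith [Nat.le_ceil (2 + R₀)]
  obtain ⟨W, hW⟩ : ∃ n : ℕ, n = ⌈2 * (sg : ℝ) / 3 + R₀ / 2 + R⌉₊ := ⟨_, rfl⟩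
  have hWge : 2 * (sg : ℝ) / 3 + R₀ / 2 + R ≤ W := by rw [hW]; exact Nat.le_ceil _
  obtain ⟨v, hv⟩ : ∃ n : ℕ, n = ⌈(R₀ + R) / 3⌉₊ + 1 := ⟨_, rfl⟩
  have hv3 : R₀ + R ≤ 3 * (v : ℝ) - 3 := by
    rw [hv]; push_cast
    have := Nat.le_ceil ((R₀ + R) / 3)
    linarith
  obtain ⟨Mb, hMb⟩ : ∃ n : ℕ, n = 2 * v + 2 := ⟨_, rfl⟩
  have hMb1 : 1 ≤ Mb := by rw [hMb]; omega
  -- the torus: `m` with `3^m > 3·Mb + R + 9`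
  obtain ⟨m, hm⟩ := pow_unbounded_of_one_lt (((3 * Mb : ℕ) : ℝ) + R + 9) (by norm_num : (1 : ℝ) < 3)
  have hX9r : (9 : ℝ) < (3 : ℝ) ^ m := by
    have : (0 : ℝ) ≤ ((3 * Mb : ℕ) : ℝ) := Nat.cast_nonneg _
    linarith
  have hX9 : 9 < 3 ^ m := by exact_mod_cast hX9r
  have hXMb : 3 * Mb < 3 ^ m := by
    have : (((3 * Mb : ℕ)) : ℝ) < (3 : ℝ) ^ m := by linarith
    exact_mod_cast this
  have hm1 : 1 ≤ m := by
    rcases Nat.eq_zero_or_pos m with h | h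
    · subst h; norm_num at hX9
    · exact h
  set P : Params := ⟨2, 3, m, 1, by norm_num, ⟨⟨1, by norm_num⟩, by norm_num⟩⟩ with hPdef
  have hN0 : P.sitesPerDir 0 = 2 * (3 * 3 ^ m) := by
    show 2 * 3 ^ (m + 1 - 0) = _
    rw [Nat.sub_zero, pow_succ, mul_comm (3 ^ m) 3]
  have hN1 : P.sitesPerDir (0 + 1) = 2 * 3 ^ m := by
    show 2 * 3 ^ (m + 1 - (0 + 1)) = _
    rw [Nat.zero_add, Nat.add_sub_cancel]
  -- the deep `k`-site `y₁ ≡ v`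
  have hvN : v < P.sitesPerDir (0 + 1) := by rw [hN1]; omega
  set y₁ : Balaban1983to89.Site P (0 + 1) := fun _ => ((v : ℕ) : ZMod (P.sitesPerDir (0 + 1))) with hy₁
  have hyv : ∀ μ : Fin P.d, (y₁ μ).val = v := by
    intro μ
    show ZMod.val ((v : ℕ) : ZMod (P.sitesPerDir (0 + 1))) = v
    rw [ZMod.val_natCast, Nat.mod_eq_of_lt hvN]
  refine ⟨P, rfl, rfl, Mb, sg, W, R, R₀, R₁, y₁, by rw [hR]; linarith, hR₁0, hR10, ?_⟩
  intro x₁ x₂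
  -- every hypothesis of `decay241_smallPlaquette_torus_cwt_uniform`
  have hbig : 2 * (P.L ^ 1 - 1) + 4 < P.sitesPerDir 0 := by rw [hN0]; show 2 * (3 ^ 1 - 1) + 4 < _; omega
  have hRk : 2 * (P.L - 1) + 4 < P.sitesPerDir (0 + 1) := by rw [hN1]; show 2 * (3 - 1) + 4 < _; omega
  have hθ : ∀ (y : Balaban1983to89.Site P 0) (μ ν : Fin P.d), ‖plaqC (expGauge P 0 fun _ => 0) y μ ν - 1‖ ≤ 0 := fun y μ ν => by
    simpa using norm_plaqC_expGauge_sub_one_le (P := P) 0 (fun _ => 0) y μ ν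
  have hθθ : (((P.L : ℝ) ^ 1) ^ 2 * 0) ^ 2 ≤ θ₀ := by rw [mul_zero]; simpa using hθ₀.le
  have hfit0 : ∀ i : Fin (1 + 1), (fun _ => 0 : Fin (1 + 1) → ℕ) i * P.L ^ 1 + P.L ^ 1 * (fun _ => Mb : Fin (1 + 1) → ℕ) i ≤
      P.sitesPerDir 0 := by
    intro i; rw [hN0]; show 0 * 3 ^ 1 + 3 ^ 1 * Mb ≤ _; omega
  have hN0' : ∀ i : Fin (1 + 1), P.L ^ 1 * (fun _ => Mb : Fin (1 + 1) → ℕ) i < P.sitesPerDir 0 := by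
    intro i; rw [hN0]; show 3 ^ 1 * Mb < _; omega
  have hRρ : (10 + ρ₀) * (P.L : ℝ) ^ 1 ≤ R := by rw [hR]; show (10 + ρ₀) * (3 : ℝ) ^ 1 ≤ _; norm_num
  have hR₁ρ : ρ₀ * (P.L : ℝ) ^ 1 ≤ R₁ := by rw [hR₁]; show ρ₀ * (3 : ℝ) ^ 1 ≤ _; norm_num
  have hmult : (⌊(((P.L : ℝ) ^ 1) - 1 + R₀) / sg⌋₊ + 3) ^ (1 + 1) ≤ 9 := by
    have hsg0 : (0 : ℝ) < sg := by exact_mod_cast hsg1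
    have hq : (((P.L : ℝ) ^ 1) - 1 + R₀) / sg < 1 := by
      rw [div_lt_one hsg0]; show ((3 : ℝ) ^ 1) - 1 + R₀ < sg; linarith
    rw [Nat.floor_eq_zero.2 hq]
    norm_num
  have hgap : ∀ i : Fin (1 + 1), ((P.L ^ 1 * (fun _ => Mb : Fin (1 + 1) → ℕ) i : ℕ) : ℝ) + R ≤ P.sitesPerDir 0 := by
    intro i; rw [hN0]; show (((3 ^ 1 * Mb : ℕ)) : ℝ) + R ≤ ((2 * (3 * 3 ^ m) : ℕ) : ℝ)
    push_cast
    have h3 : (0 : ℝ) ≤ (3 : ℝ) ^ m := by positivity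
    have hm' : ((3 * Mb : ℕ) : ℝ) + R + 9 < (3 : ℝ) ^ m := hm
    push_cast at hm'
    linarith
  have hΛ : ∀ y ∈ ({y₁} : Finset (Balaban1983to89.Site P (0 + 1))), ∀ μ : Fin P.d,
      ((fun _ => 0 : Fin (1 + 1) → ℕ) (Fin.cast (rfl : P.d = 1 + 1) μ) : ℝ) * P.L ^ 1 + (R₀ + R) ≤ (P.L : ℝ) ^ 1 * (y μ).val ∧
        (P.L : ℝ) ^ 1 * (y μ).val + P.L ^ 1 + (R₀ + R) ≤
          ((fun _ => 0 : Fin (1 + 1) → ℕ) (Fin.cast (rfl : P.d = 1 + 1) μ) : ℝ) * P.L ^ 1 +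
            (P.L : ℝ) ^ 1 * (fun _ => Mb : Fin (1 + 1) → ℕ) (Fin.cast (rfl : P.d = 1 + 1) μ) := by
    intro y hy μ
    rw [Finset.mem_singleton] at hy
    subst hy
    rw [hyv μ]
    show ((0 : ℕ) : ℝ) * (3 : ℝ) ^ 1 + (R₀ + R) ≤ (3 : ℝ) ^ 1 * (v : ℕ) ∧
      (3 : ℝ) ^ 1 * (v : ℕ) + (3 : ℝ) ^ 1 + (R₀ + R) ≤ ((0 : ℕ) : ℝ) * (3 : ℝ) ^ 1 + (3 : ℝ) ^ 1 * (Mb : ℕ)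
    rw [hMb]; push_cast
    constructor <;> linarith
  exact M P rfl rfl 1 le_rfl le_rfl (by show 1 + 1 ≤ m + 1; omega) hbig hRk (expGauge P 0 fun _ => 0) 0 le_rfl hθ hθθ
    (fun _ => 0) (fun _ => Mb) (fun _ => hMb1) hfit0 hN0' sg W hsg1 R R₀ R₁ hRρ hR₁ρ hR10 hmult hWge hgap {y₁} hΛ x₁ x₂

end Instance

end

end Literature.MathematicalPhysics.QuantumFieldTheory.BalabanImbrieJaffe1984to88.BIJ88DeltaLocSmallPlaquetteTorusCwtGauge
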